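import Summits.FinalStateConjecture.FinalStateConjecture.Theses.ZeroEnergyKerrOrBomb
import Summits.FinalStateConjecture.FinalStateConjecture.Theses.AnalyticityInvadesErgoregion
import Literature.Geometry.Lorentzian.CausalityOpennessProofs
import Literature.Geometry.Lorentzian.LeviCivitaLocality
import Literature.Geometry.Lorentzian.MullerZumHagenAnalyticity
import Literature.Geometry.Lorentzian.KillingHorizonShadowAlong
import Literature.Geometry.Lorentzian.FlowInvariantFunctions
import Literature.Geometry.Lorentzian.DocStructureTimeFunction
import Mathlib.Analysis.Normed.Module.Connected
-- LANDED stub S4a (p137190, wave 2) and the tree's Killing patching on immersed chart images (crux GapExhaustion)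
import Summits.FinalStateConjecture.FinalStateConjecture.Theorems.ZeroEnergyKerrOrBombNonTrappingHawkingRigidityStubTwoVariableAnalyticitySeeds
import Summits.FinalStateConjecture.FinalStateConjecture.Theorems.ZeroEnergyKerrOrBombNonTrappingHawkingRigidityStubInvariantKillingSubcollar
import Summits.FinalStateConjecture.FinalStateConjecture.Theorems.ZeroEnergyKerrOrBombNonTrappingHawkingRigidityStubSlabPatching
import Summits.FinalStateConjecture.FinalStateConjecture.Theorems.BartnikGapSettlingGapExhaustionIsKillingFieldOnPatching
-- scratch check against the one landed Negative lemma of this crux (cdisprove cycle 1,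
-- `Theorems/NonTrappingHawkingRigidity/Negative/KillingNonvanishingOfIPlusRegular.lean`): it says h4
-- (`T ≠ 0` on the d.o.c.) follows from h2; no stub below uses h4, so none is an instance of it.
import Summits.FinalStateConjecture.FinalStateConjecture.Theorems.NonTrappingHawkingRigidity.Negative.KillingNonvanishingOfIPlusRegular

/-!
# Line `Sketch` (idea `azimuthal-partial-analyticity`) — crux `NonTrappingHawkingRigidity`
# (stmt-FinalStateConjecture-13896), skeleton of the lead (gen 1)

Crux (shared by routes `ZeroEnergyKerrOrBomb` rank 2 and `AnalyticityInvadesErgoregion` rank 4; the two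
route decls have letter-identical bodies): a vacuum, `I⁺`-regular, future-presented stationary AF black
hole `𝓑` with `T ≠ 0` on the d.o.c., simply connected d.o.c., a Killing–timelike collar `(U, K)` on a
connected horizon, closed-ergoregion belt compact modulo `T` and no zero-energy null geodesic trapped
modulo `T`, admits `K'` smooth and Killing on the d.o.c. with `[T, K'] = 0` and `K' = K` near `𝓔⁺`.

## THE LINE (two analytic variables void Tataru's residual set; sweep by timelike level sets)

The idea card (`Cruxes/NonTrappingHawkingRigidity/Ideas/azimuthal-partial-analyticity.md`, ideator 1;
convergent with ideator 2's `azimuthal-time-tataru`): the Tataru–Robbiano–Zuily–Hörmander unique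
continuation theorem for operators whose coefficients are ANALYTIC IN A GROUP OF VARIABLES `x_a`, applied
with TWO variables `x_a = (x⁰, x¹)` spanning a TIMELIKE coordinate 2-plane, has an EMPTY residual
characteristic set `Char ∩ {ξ₀ = ξ₁ = 0}` (a null covector cannot annihilate a timelike 2-plane:
`SketchIdeator1.orthogonalOfTimelikePlaneIsSpacelike_holds`, kernel-checked), so its only geometric
requirement on the hypersurface to be crossed is NON-CHARACTERISTICITY (non-null conormal) — no
`T`-conditional pseudo-convexity, no exposed points, the ergosurface is an ordinary point.  On the KNOWN
(stationary–axisymmetric) side both Killing parameters are such variables for free; the one thing to be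
MANUFACTURED is the regularity statement C⁺ of the card — the metric is real-analytic in a second,
auxiliary direction across the hair (AXIAL / TWO-VARIABLE ANALYTICITY, `TwoVariableAnalyticAt`) — which
the card feeds from the non-trapping hypothesis h16 used as a geometric-control condition (semiclassical
non-trapping bound + paraproduct cascade in the periodic variable).  With C⁺ in hand the Killing collar
field is continued outward across the level sets of a `T`-invariant SWEEP FUNCTION WITH SPACELIKE
GRADIENT (timelike, hence non-characteristic, level hypersurfaces; on Kerr `f = r`), and because the
continuation is organised by ONE global function its single-valuedness is automatic (no monodromy, no
Nomizu endgame, no analyticity of the full d.o.c.): the composition below is a Zorn / supremum argument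
over anchored partial continuations `(c, L)` = "`L` is a `T`-commuting Killing field on `{f < c} ∩ doc`
equal to the collar field on the collar".

* S1a `stub_invariantKillingSubcollar` — a `T`-INVARIANT KILLING SUB-COLLAR: an open `U₁ ⊇ 𝓔⁺` with
  flow-invariant trace on the d.o.c. carrying a local `T`-commuting Killing field `K₁` equal to `K` near
  `𝓔⁺` (transport of `K` by the stationary isometries from the slice of the Chruściel–Costa equivariant
  time function, rev 3.4: that function is the stub's first hypothesis).  LANDED p139503 (wave 3, rev 3.6).
* S1c `stub_docTimeFunction` — literature debt (rev 3.4): Chruściel–Costa 2008 Thm. 4.5, time-function part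
  (`t` smooth on the d.o.c., continuous up to `𝓔⁺`, `t ∘ φₛ = t + s`) = the named fact
  `chruscielCosta2008_equivariantTimeFunction` (LANDED p138635; by name since rev 3.5).  [size L–XL]
* S1b `stub_invariantRadialFunction` (rev 4; was `stub_beltTimelikeSweep`, rev 3.3) — STRUCTURE ONLY: a
  horizon-adapted `T`-invariant radial function of the d.o.c. (R1)–(R6) (CC08 Thm. 4.5 product structure +
  slice topology `S̄₀ ≈ S² × [0, ∞)`; theorem-level, in print, XL as a formalization); the former BET (spacelike
  gradient on the closed ergoregion) is now an OUTPUT of the adapted engine S4b; `sweep_of_radial` turns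
  `ρ` into the timelike sweep `(U', f, c₀)` the composition consumes.  [size XL; literature debt]
* S2 `stub_pointContinuation` — THE IN-PRINT LEVER: in a vacuum `𝓑`, a local `T`-commuting Killing
  field on an open `D ⊆ doc` continues to a neighbourhood of any point `q` at which `D` contains the
  strict sub-level side of a smooth function with NON-NULL gradient (`NonNullSupportAt`) and the metric
  is two-variable analytic (`TwoVariableAnalyticAt`).  [Tataru 1999 Thm 1 / Robbiano–Zuily 1998 Thm A /
  Hörmander 1997 — scalar form now the tree's named fact `Literature.Analysis.PDE.Tataru1999_partialAnalyticUniqueContinuation`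
  (p136908) — on the Ionescu–Klainerman Killing-extension system (the system UCP is NOT in print: W7); size L–XL]
* S3 `stub_slabPatching` — FROM POINTWISE TO A UNIFORM SLAB: pointwise continuations at every point of
  the level `{f = c}` patch, by one-jet uniqueness of Killing fields in gradient-saturated boxes,
  compactness of the level modulo `T` and transport by the stationary isometries, to ONE continuation on
  `{f < c + ε} ∩ doc`.  LANDED p139035 (wave-1 worker W3 + 8 support files; rev 3.6).
* S4a `stub_twoVariableAnalyticitySeeds` — LANDED p137190 (wave 2): the FREE part of C⁺, two-variable
  analyticity where `T` is timelike and on the collar, from Müller zum Hagen (explicit hypothesis = debt S4c)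
  + chart tilt + the tree's Cauchy estimates; imported below and used inside `NonTrappingHawkingRigidity_of`.
* S4b `stub_adaptedAnalyticSweep` (rev 4; was `stub_twoVariableAnalyticityBelt`) — THE ENGINE C⁺ IN ADAPTED
  FORM (open; the lead holds it): a radial function `ρ` and, at every closed-ergoregion point of the d.o.c.,
  a two-variable analytic chart whose timelike analytic plane is TANGENT TO THE LEVEL OF `ρ` (so `dρ` is
  spacelike there: `TwoVariableAnalyticAdaptedAt.spacelike_gradient`).  [the crux's open content; size XL]
* S4c `stub_mullerZumHagen` — literature debt: the vendored named fact
  `mullerZumHagen1970_analytic_of_timelikeKilling` (Disproof (F5): vacuum on `{g(T,T) < 0}`).  [size L]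
* Composition `NonTrappingHawkingRigidity_of` (sorry-free): Zorn on anchored partial continuations
  ordered by extension; chains glue (locality of smoothness, of the Levi-Civita connection and of the
  Lie bracket: §2); a maximal element of finite level would be strictly extended by S4a/b + S2 + S3; so its
  level is `⊤`, i.e. its field lives on the whole d.o.c. — the crux's `K'`, docking on `U' ∩ U''`.

Hypotheses of the crux NOT consumed by the composition: simple connectivity of the d.o.c. (idle in this
line: the sweep organises single-valuedness), `T ≠ 0` on the d.o.c. (redundant anyway: Negative lemma
`KillingNonvanishingOfIPlusRegular`).  Vacuum enters S2, S4a (through S4c) and S4b; `I⁺`-regularity S1a/b/c, S3; the collar S1a, S4a; belt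
compactness S1b (properness of the sweep mod `T`) and S4b; non-trapping h16 ONLY S4b.

## Disproof.lean honoured (cdisprove cycle 1, `Cruxes/NonTrappingHawkingRigidity/Disproof.lean`, read 01:35Z)

NO KILL; two sorried near-misses.  (F5) `false_without_H1` — vacuum is load-bearing ON `{g(T,T) < 0} ∖ U`
too: honoured, S4 consumes h1 there (Müller zum Hagen analyticity is a VACUUM theorem) and S2 consumes h1 at
every level point of the sweep, inside and outside the belt ("belt analysis + abstract continuation outward"
is NOT this line: the sweep crosses the `T`-timelike region with the same vacuum UCP).  (F6) `not_dockOnU` —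
docking on all of `U` is false: S1 asks `K₀ = K` only on `U'' ∩ doc` for SOME open `U'' ⊇ 𝓔⁺` and the
composition docks on `U' ∩ U''`.  (F4) scale/orientation of `K` free: no stub mentions `κ`, `Ω_H` or a
normalisation.  (F7).3 h13 (whole-line tangency) is used by no stub; (F7).4 the `T`-invariant sub-collar is
NOT taken WLOG but is S1's explicit burden (flow transport + `[T,K] = 0`, the disprover's 1-jet remark).
(F9) "uniform UC neighbourhoods / translates": S3's uniformity is modulo `T` by compactness of the level mod
`T` and transport by the stationary isometries.  (F1) h4 redundant (landed Negative lemma, imported below as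
a scratch check): h4 is carried verbatim in S1/S4's binders and used by nothing.
-/

set_option linter.dupNamespace false
set_option linter.unusedVariables false
set_option linter.unusedSectionVars false

noncomputable section

namespace Summit.FinalStateConjecture.FinalStateConjecture.Cruxes.NonTrappingHawkingRigidity.AzimuthalPartialAnalyticity

-- the crux BY NAME: the item's decl in its first route file (the `ZeroEnergyKerrOrBomb` copy has a
-- letter-identical body and is closed definitionally, see the end of the file)
open Summit.FinalStateConjecture.FinalStateConjecture.Theses.AnalyticityInvadesErgoregion (NonTrappingHawkingRigidity)
open Literature.Geometry.Lorentzian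
open scoped Manifold ContDiff Topology Nat
open Set Filter

/-! ## §1 Vocabulary (over existing declarations only) -/

section Vocabulary

variable (𝓑 : StationaryAFBlackHole.{0}) [𝓑.metric.HasLeviCivita]

/-- `L` is a LOCAL `T`-COMMUTING KILLING FIELD on the set `W`: smooth as a section of `TM` on `W`, the
Killing equation `g(∇_v L, w) + g(v, ∇_w L) = 0` at every point of `W`, and `[T, L] = 0` on `W`
(`T = 𝓑.killing`) — verbatim the three clauses the crux imposes on the collar field and on `K'`
(vocabulary shared with `Cruxes/ZeroEnergyRigidity/Lines/osculating-frontier-induction.lean`).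
[cite: ONeill1983, Ch. 9, Def. 9.22] -/
def IsLocalKilling (W : Set 𝓑.carrier) (L : Π x : 𝓑.carrier, TangentSpace (𝓡 4) x) : Prop :=
  ContMDiffOn (𝓡 4) ((𝓡 4).prod 𝓘(ℝ, E4)) ((⊤ : ℕ∞) : WithTop ℕ∞)
      (fun x ↦ (Bundle.TotalSpace.mk' E4 x (L x) : TangentBundle (𝓡 4) 𝓑.carrier)) W ∧
    (∀ x ∈ W, ∀ v w : TangentSpace (𝓡 4) x,
      𝓑.metric.val x (𝓑.metric.leviCivita L x v) w + 𝓑.metric.val x v (𝓑.metric.leviCivita L x w) = 0) ∧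
    ∀ x ∈ W, VectorField.mlieBracket (𝓡 4) 𝓑.killing L x = 0

/-- The KILLING–TIMELIKE COLLAR hypotheses on `(U, K)` — verbatim the crux: `U` open, `U ⊇ 𝓔⁺`, `𝓔⁺`
connected, `K` a local `T`-commuting Killing field on `U`, non-zero and flow-tangent on `𝓔⁺`, timelike
on `U ∩ doc`. [cite: AlexakisIonescuKlainerman2010, Thm. 1.1] -/
def IsKillingTimelikeCollar (U : Set 𝓑.carrier) (K : Π x : 𝓑.carrier, TangentSpace (𝓡 4) x) : Prop :=
  IsOpen U ∧ 𝓑.horizon ⊆ U ∧ IsConnected 𝓑.horizon ∧ IsLocalKilling 𝓑 U K ∧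
    (∀ p ∈ 𝓑.horizon, K p ≠ 0) ∧
    (∀ γ : ℝ → 𝓑.carrier, IsMIntegralCurve γ K → γ 0 ∈ 𝓑.horizon → ∀ t, γ t ∈ 𝓑.horizon) ∧
    ∀ x ∈ U ∩ 𝓑.doc, 𝓑.metric.val x (K x) (K x) < 0

/-- The closed-ergoregion BELT off the collar is compact modulo the stationary flow — verbatim the
crux's h15. [cite: ChruscielCosta2008, §4] -/
def BeltCompactModFlow (U : Set 𝓑.carrier) : Prop :=
  ∃ S₀ : Set 𝓑.carrier, IsCompact S₀ ∧ S₀ ⊆ 𝓑.doc ∧ ∀ y ∈ 𝓑.doc,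
    0 ≤ 𝓑.metric.val y (𝓑.killing y) (𝓑.killing y) → y ∉ U → y ∈ stationaryOrbit 𝓑.killing S₀

/-- NO ZERO-ENERGY NULL GEODESIC TRAPPED MODULO THE FLOW — verbatim the crux's h16 (the
Alexakis–Ionescu–Klainerman hypothesis taken modulo the stationary flow). [cite: IonescuKlainerman2015, §4] -/
def NoTrappedGeodesicModFlow : Prop :=
  ∀ S : Set 𝓑.carrier, IsCompact S → S ⊆ 𝓑.doc → ∀ (γ : ℝ → 𝓑.carrier) (s : Set ℝ),
    IsMaximalGeodesicOn 𝓑.metric.toPseudoRiemannianMetric.leviCivita γ s → s.Nonempty →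
      (∀ t ∈ s, 𝓑.metric.val (γ t) (velocity (𝓡 4) γ t) (velocity (𝓡 4) γ t) = 0 ∧
        velocity (𝓡 4) γ t ≠ 0 ∧ 𝓑.metric.val (γ t) (velocity (𝓡 4) γ t) (𝓑.killing (γ t)) = 0) →
      ∃ t ∈ s, γ t ∉ stationaryOrbit 𝓑.killing S

/-- The REGULAR TELESCOPE = the hypotheses of the crux minus simple connectivity and `T ≠ 0`: vacuum,
`I⁺`-regular, future-presented, Killing–timelike collar, belt compact mod `T`, zero-energy non-trapping
mod `T` (documentation only: the registered stubs S1/S4 carry the crux's binders h1–h16 VERBATIM, so that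
a landed stub matches the registered signature letter for letter). [cite: ChruscielCosta2008, Def. 1.1] -/
def RegularTelescope (U : Set 𝓑.carrier) (K : Π x : 𝓑.carrier, TangentSpace (𝓡 4) x) : Prop :=
  𝓑.metric.toPseudoRiemannianMetric.IsRicciFlat ∧ 𝓑.IsIPlusRegular ∧
    (∀ p : 𝓑.carrier, p ∈ 𝓑.metric.chronologicalFuture 𝓑.timeOrientation 𝓑.Mext) ∧
    IsKillingTimelikeCollar 𝓑 U K ∧ BeltCompactModFlow 𝓑 U ∧ NoTrappedGeodesicModFlow 𝓑

/-- The strict sub-level set `{x ∈ doc | f x < c}` of a sweep function inside the d.o.c. [folklore] -/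
def subLevel (f : 𝓑.carrier → ℝ) (c : ℝ) : Set 𝓑.carrier :=
  {x | x ∈ 𝓑.doc ∧ f x < c}

/-- **A `T`-invariant TIMELIKE SWEEP of the d.o.c. off the sub-collar `U'`** (`IsTimelikeSweep 𝓑 U' f c₀`):
`f` is smooth on the d.o.c. and `T`-invariant (`df(T) = 0`); the sub-collar is its bottom sub-level set,
`{f < c₀} ∩ doc = U' ∩ doc`; off the sub-collar `df = g(w, ·)` for a SPACELIKE `w` (so the level sets
are `T`-invariant TIMELIKE — non-characteristic — hypersurfaces, and `df ≠ 0` there); and every slab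
`{c₀ ≤ f ≤ c} ∩ doc` is compact modulo the stationary flow.  On Kerr: `f = r` (Boyer–Lindquist /
Kerr–Schild radius), `U' = {r < r₊ + δ}`, `g^{rr} = Δ/Σ > 0`.  This is the card's "(T,Ẑ)-invariant
height" in its weakest usable form and ideator 2's object `HasTimelikeSweep`. [cite: AlexakisIonescuKlainerman2010, §1 (the `r`-foliation)] -/
def IsTimelikeSweep (U' : Set 𝓑.carrier) (f : 𝓑.carrier → ℝ) (c₀ : ℝ) : Prop :=
  ContMDiffOn (𝓡 4) 𝓘(ℝ, ℝ) ((⊤ : ℕ∞) : WithTop ℕ∞) f 𝓑.doc ∧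
    (∀ x ∈ 𝓑.doc, mfderiv (𝓡 4) 𝓘(ℝ, ℝ) f x (𝓑.killing x) = 0) ∧
    subLevel 𝓑 f c₀ = U' ∩ 𝓑.doc ∧
    (∀ x ∈ 𝓑.doc, c₀ ≤ f x → ∃ w : TangentSpace (𝓡 4) x, 0 < 𝓑.metric.val x w w ∧
      ∀ u : TangentSpace (𝓡 4) x, mfderiv (𝓡 4) 𝓘(ℝ, ℝ) f x u = 𝓑.metric.val x w u) ∧
    ∀ c : ℝ, ∃ S : Set 𝓑.carrier, IsCompact S ∧ S ⊆ 𝓑.doc ∧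
      {x | x ∈ 𝓑.doc ∧ c₀ ≤ f x ∧ f x ≤ c} ⊆ stationaryOrbit 𝓑.killing S

/-- **`D` supports `q` through a NON-NULL level of `f`** (`NonNullSupportAt 𝓑 D q f`): on an open
`N ∋ q`, `f` is smooth, `df(q) = g(n, ·)` for a NON-NULL `n` (`g(n,n) ≠ 0`: the level hypersurface
`{f = f q}` is non-characteristic for `□_g` at `q`), and the strict sub-level side `{f < f q} ∩ N ∩ doc`
IS the trace of `D` on `N ∩ doc` (the known side near `q` is exactly the sub-level side: `D` carries no
unrelated pieces above the level near `q`).  No `T`-invariance and NO CONVEXITY of any kind is asked —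
this is the whole point of the line (contrast `ExposedAt` of the osculating-frontier line). [cite: Tataru1999PartiallyAnalytic, Thm. 1] -/
def NonNullSupportAt (D : Set 𝓑.carrier) (q : 𝓑.carrier) (f : 𝓑.carrier → ℝ) : Prop :=
  ∃ N : Set 𝓑.carrier, IsOpen N ∧ q ∈ N ∧
    ContMDiffOn (𝓡 4) 𝓘(ℝ, ℝ) ((⊤ : ℕ∞) : WithTop ℕ∞) f N ∧
    (∃ nq : TangentSpace (𝓡 4) q, 𝓑.metric.val q nq nq ≠ 0 ∧
      ∀ w : TangentSpace (𝓡 4) q, mfderiv (𝓡 4) 𝓘(ℝ, ℝ) f q w = 𝓑.metric.val q nq w) ∧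
    ∀ x ∈ N ∩ 𝓑.doc, x ∈ D ↔ f x < f q

/-- The metric components in the chart `ψ`: `G_{ab}(p) = g_{ψ⁻¹ p}(dψ⁻¹_p a, dψ⁻¹_p b)` (as in the route
file's `let An` of `ErgoregionAnalyticity` / `NomizuAcrossAnalyticDoc`). [folklore] -/
def chartMetric (ψ : OpenPartialHomeomorph 𝓑.carrier E4) (a b : E4) (p : E4) : ℝ :=
  𝓑.metric.val (ψ.symm p) (mfderiv 𝓘(ℝ, E4) (𝓡 4) ψ.symm p a) (mfderiv 𝓘(ℝ, E4) (𝓡 4) ψ.symm p b)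

/-- **TWO-VARIABLE (AXIAL) ANALYTICITY of the metric at `q`** — the regularity class C⁺ of the card,
stated chartwise by FACTORIAL DERIVATIVE BOUNDS (the tree's language for real-analyticity:
`AnalyticAt.exists_ball_norm_iteratedFDeriv_le` / `analyticOnNhd_of_locally_norm_iteratedFDeriv_le` in
`Literature/Analysis/Calculus/`): there is a chart `ψ` of the maximal smooth atlas around `q` such that
(i) the coordinate 2-plane `span{∂₀, ∂₁}` at `q` is TIMELIKE (contains a timelike vector) — so Tataru's
residual characteristic set `Char ∩ {ξ₀ = ξ₁ = 0}` is empty at (hence near) `q` —, and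
(ii) for every pair `a b` (constants depending on the pair: the components are bilinear in `(a, b)`; the
finitely many basis pairs give common constants), on a coordinate ball around `ψ q` inside the chart target the
component `G_{ab}(p) = g_{ψ⁻¹ p}(dψ⁻¹ a, dψ⁻¹ b)` is `C^∞` and satisfies UNIFORM Cauchy estimates in the two
directions `e₀, e₁`: `‖Dᵏ G_{ab}(z)(v₁,…,v_k)‖ ≤ M Cᵏ k!` for all `k`, all `z` in the ball and all `vᵢ ∈ {e₀, e₁}` —
equivalently (Krantz–Parks Prop. 2.2.10, slice-wise) the components are real-analytic in `(x⁰, x¹)`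
uniformly in `(x², x³)`, the hypothesis form of Tataru 1999 / Robbiano–Zuily 1998 / Hörmander 1997
("coefficients `C^∞`, analytic in the variables `x_a`").  Where the metric carries two commuting Killing
fields with timelike span a joint flow-box chart gives components INDEPENDENT of `(x⁰, x¹)`; where the
metric is real-analytic in all four variables (the `T`-timelike region and the collar, Müller zum Hagen
1970) the bounds hold in all directions.  The content of C⁺ is the belt.
[cite: RobbianoZuily1998, Thm. A] [cite: Hormander1997PartialAnalyticity, Thm. 1] [cite: KrantzParks2002, Prop. 2.2.10] -/
def TwoVariableAnalyticAt (q : 𝓑.carrier) : Prop :=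
  ∃ ψ ∈ IsManifold.maximalAtlas (𝓡 4) ((⊤ : ℕ∞) : WithTop ℕ∞) 𝓑.carrier, q ∈ ψ.source ∧
    (∃ a b : ℝ, 𝓑.metric.val q
        (a • mfderiv 𝓘(ℝ, E4) (𝓡 4) ψ.symm (ψ q) (EuclideanSpace.single 0 1) +
          b • mfderiv 𝓘(ℝ, E4) (𝓡 4) ψ.symm (ψ q) (EuclideanSpace.single 1 1))
        (a • mfderiv 𝓘(ℝ, E4) (𝓡 4) ψ.symm (ψ q) (EuclideanSpace.single 0 1) +
          b • mfderiv 𝓘(ℝ, E4) (𝓡 4) ψ.symm (ψ q) (EuclideanSpace.single 1 1)) < 0) ∧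
    ∀ a b : E4, ∃ δ > (0 : ℝ), ∃ M C : ℝ, 0 ≤ M ∧ 0 ≤ C ∧ Metric.ball (ψ q) δ ⊆ ψ.target ∧
      ContDiffOn ℝ ((⊤ : ℕ∞) : WithTop ℕ∞) (chartMetric 𝓑 ψ a b) (Metric.ball (ψ q) δ) ∧
      ∀ z ∈ Metric.ball (ψ q) δ, ∀ (k : ℕ) (v : Fin k → E4),
        (∀ i, v i = EuclideanSpace.single 0 1 ∨ v i = EuclideanSpace.single 1 1) →
        ‖iteratedFDeriv ℝ k (chartMetric 𝓑 ψ a b) z v‖ ≤ M * C ^ k * k !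

/-- **Two-variable analyticity at `q` in a chart ADAPTED to the function `ρ`** (rev 4): as
`TwoVariableAnalyticAt`, and in addition the analytic coordinate plane `span{∂₀, ∂₁}` at `q` is tangent to the
level set of `ρ` through `q` (`dρ_q(∂₀) = dρ_q(∂₁) = 0`).  Since that plane contains a timelike vector, `dρ_q`
(if non-zero) is the `g`-dual of a SPACELIKE vector: the level of `ρ` is a timelike — non-characteristic —
hypersurface at `q` (`spacelike_gradient_of_adapted`). [cite: Tataru1999PartiallyAnalytic, Thm. 1]
[cite: ONeill1983, Ch. 5, Lemma 5.26] -/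
def TwoVariableAnalyticAdaptedAt (ρ : 𝓑.carrier → ℝ) (q : 𝓑.carrier) : Prop :=
  ∃ ψ ∈ IsManifold.maximalAtlas (𝓡 4) ((⊤ : ℕ∞) : WithTop ℕ∞) 𝓑.carrier, q ∈ ψ.source ∧
    (∃ a b : ℝ, 𝓑.metric.val q
        (a • mfderiv 𝓘(ℝ, E4) (𝓡 4) ψ.symm (ψ q) (EuclideanSpace.single 0 1) +
          b • mfderiv 𝓘(ℝ, E4) (𝓡 4) ψ.symm (ψ q) (EuclideanSpace.single 1 1))
        (a • mfderiv 𝓘(ℝ, E4) (𝓡 4) ψ.symm (ψ q) (EuclideanSpace.single 0 1) +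
          b • mfderiv 𝓘(ℝ, E4) (𝓡 4) ψ.symm (ψ q) (EuclideanSpace.single 1 1)) < 0) ∧
    mfderiv (𝓡 4) 𝓘(ℝ, ℝ) ρ q (mfderiv 𝓘(ℝ, E4) (𝓡 4) ψ.symm (ψ q) (EuclideanSpace.single 0 1)) = 0 ∧
    mfderiv (𝓡 4) 𝓘(ℝ, ℝ) ρ q (mfderiv 𝓘(ℝ, E4) (𝓡 4) ψ.symm (ψ q) (EuclideanSpace.single 1 1)) = 0 ∧
    ∀ a b : E4, ∃ δ > (0 : ℝ), ∃ M C : ℝ, 0 ≤ M ∧ 0 ≤ C ∧ Metric.ball (ψ q) δ ⊆ ψ.target ∧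
      ContDiffOn ℝ ((⊤ : ℕ∞) : WithTop ℕ∞) (chartMetric 𝓑 ψ a b) (Metric.ball (ψ q) δ) ∧
      ∀ z ∈ Metric.ball (ψ q) δ, ∀ (k : ℕ) (v : Fin k → E4),
        (∀ i, v i = EuclideanSpace.single 0 1 ∨ v i = EuclideanSpace.single 1 1) →
        ‖iteratedFDeriv ℝ k (chartMetric 𝓑 ψ a b) z v‖ ≤ M * C ^ k * k !

/-- **A ONE-STEP CONTINUATION of `(D, L)` AT `q`** (`PointContinuationAt 𝓑 D L q`): an open `W ∋ q`
inside the d.o.c. and a local `T`-commuting Killing field `L'` on `W` which agrees with `L` on ALL of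
`W ∩ D` (the known side near `q`). [cite: IonescuKlainerman2012, Thm. 1.2 (shape of the conclusion)] -/
def PointContinuationAt (D : Set 𝓑.carrier) (L : Π x : 𝓑.carrier, TangentSpace (𝓡 4) x)
    (q : 𝓑.carrier) : Prop :=
  ∃ (W : Set 𝓑.carrier) (L' : Π x : 𝓑.carrier, TangentSpace (𝓡 4) x),
    IsOpen W ∧ q ∈ W ∧ W ⊆ 𝓑.doc ∧ IsLocalKilling 𝓑 W L' ∧ ∀ x ∈ W ∩ D, L' x = L x

end Vocabulary

/-! ### The radial function of S1b (wave-2 worker W5's `IsInvariantRadialFunction`, verbatim) -/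

section Bet

/-- **A `T`-invariant radial function of the d.o.c. adapted to the horizon.**  `ρ : M → ℝ` is
(R1) smooth on `⟨⟨M_ext⟩⟩ = 𝓑.doc`; (R2) `T`-invariant there, `dρ(T) = 0`; (R3) regular there, `dρ ≠ 0`;
(R4) HORIZON-ADJACENT: every sub-level `{ρ < c} ∩ doc`, `c > 0`, is the trace `U' ∩ doc` of an open `U' ⊇ 𝓔⁺`;
(R5) THIN: every open `U₁ ⊇ 𝓔⁺` whose trace on the d.o.c. is invariant under the whole-line integral curves of `T`
contains some `{ρ < c} ∩ doc`, `c > 0`; (R6) PROPER MODULO `T`: every slab `{c₀ ≤ ρ ≤ c} ∩ doc`, `c₀ > 0`, lies in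
the `T`-orbit of a compact subset of the d.o.c.  On Kerr (ingoing Kerr–Schild or Boyer–Lindquist exterior):
`ρ = r - r₊`.  For an `I⁺`-regular, future-presented, vacuum black hole with connected horizon such a `ρ` is the
`[0, ∞)`-coordinate of `S̄₀ ≈ S² × [0, ∞)` lifted along `⟨⟨M_ext⟩⟩ ∪ 𝓔⁺ ≈ ℝ × S̄₀` (Chruściel–Costa 2008, Thm. 4.5
with Cor. 2.4–2.5 and the Poincaré conjecture); see `HasInvariantRadialFunction`.  A DEFINITION (a predicate on
`(𝓑, ρ)`; wave-2 worker W5's `IsInvariantRadialFunction`, verbatim). [cite: ChruscielCosta2008, Thm. 4.5] -/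
def IsInvariantRadialFunction (𝓑 : StationaryAFBlackHole.{0}) (ρ : 𝓑.carrier → ℝ) : Prop :=
  ContMDiffOn (𝓡 4) 𝓘(ℝ, ℝ) ((⊤ : ℕ∞) : WithTop ℕ∞) ρ 𝓑.doc ∧
  (∀ x ∈ 𝓑.doc, mfderiv (𝓡 4) 𝓘(ℝ, ℝ) ρ x (𝓑.killing x) = 0) ∧
  (∀ x ∈ 𝓑.doc, mfderiv (𝓡 4) 𝓘(ℝ, ℝ) ρ x ≠ 0) ∧
  (∀ c : ℝ, 0 < c → ∃ U' : Set 𝓑.carrier, IsOpen U' ∧ 𝓑.horizon ⊆ U' ∧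
    U' ∩ 𝓑.doc = {x | x ∈ 𝓑.doc ∧ ρ x < c}) ∧
  (∀ U₁ : Set 𝓑.carrier, IsOpen U₁ → 𝓑.horizon ⊆ U₁ →
    (∀ γ : ℝ → 𝓑.carrier, IsMIntegralCurve γ 𝓑.killing → γ 0 ∈ U₁ ∩ 𝓑.doc →
      ∀ t, γ t ∈ U₁ ∩ 𝓑.doc) →
    ∃ c : ℝ, 0 < c ∧ {x | x ∈ 𝓑.doc ∧ ρ x < c} ⊆ U₁) ∧
  (∀ c₀ c : ℝ, 0 < c₀ → ∃ S : Set 𝓑.carrier, IsCompact S ∧ S ⊆ 𝓑.doc ∧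
    {x | x ∈ 𝓑.doc ∧ c₀ ≤ ρ x ∧ ρ x ≤ c} ⊆ stationaryOrbit 𝓑.killing S)

end Bet

/-! ## §2 Small facts (sorry-free): openness, locality, gluing -/

section Facts

variable (𝓑 : StationaryAFBlackHole.{0}) [𝓑.metric.HasLeviCivita]

/-- The d.o.c. is open (O'Neill Lemma 14.3, PROVED in the tree for boundaryless carriers:
`isOpen_chronologicalFuture/Past_holds_of_boundaryless`). [cite: ONeillSemiRiemannian1983, Ch. 14, Lemma 14.3] -/
theorem isOpen_doc : IsOpen 𝓑.doc :=
  𝓑.isOpen_doc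
    (LorentzianMetric.isOpen_chronologicalFuture_holds_of_boundaryless (g := 𝓑.metric) (τ := 𝓑.timeOrientation))
    (LorentzianMetric.isOpen_chronologicalPast_holds_of_boundaryless (g := 𝓑.metric) (τ := 𝓑.timeOrientation))

variable {𝓑}

/-- Unfolding lemma for `subLevel`. [folklore] -/
@[simp] theorem mem_subLevel {f : 𝓑.carrier → ℝ} {c : ℝ} {x : 𝓑.carrier} :
    x ∈ subLevel 𝓑 f c ↔ x ∈ 𝓑.doc ∧ f x < c := Iff.rfl

/-- Sub-level sets are monotone in the level. [folklore] -/
theorem subLevel_mono (f : 𝓑.carrier → ℝ) {c c' : ℝ} (h : c ≤ c') : subLevel 𝓑 f c ⊆ subLevel 𝓑 f c' :=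
  fun _ hx ↦ ⟨hx.1, lt_of_lt_of_le hx.2 h⟩

/-- Sub-level sets lie in the d.o.c. [folklore] -/
theorem subLevel_subset_doc (f : 𝓑.carrier → ℝ) (c : ℝ) : subLevel 𝓑 f c ⊆ 𝓑.doc := fun _ hx ↦ hx.1

/-- A sub-level set of a function continuous on the (open) d.o.c. is open. [folklore] -/
theorem isOpen_subLevel {f : 𝓑.carrier → ℝ} (hf : ContinuousOn f 𝓑.doc) (c : ℝ) :
    IsOpen (subLevel 𝓑 f c) :=
  hf.isOpen_inter_preimage (isOpen_doc 𝓑) isOpen_Iio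

/-- Restriction of a local `T`-commuting Killing field to a subset. [folklore] -/
theorem IsLocalKilling.mono {W W' : Set 𝓑.carrier} {L : Π x : 𝓑.carrier, TangentSpace (𝓡 4) x}
    (h : IsLocalKilling 𝓑 W L) (hW : W' ⊆ W) : IsLocalKilling 𝓑 W' L :=
  ⟨h.1.mono hW, fun x hx ↦ h.2.1 x (hW hx), fun x hx ↦ h.2.2 x (hW hx)⟩

/-! ### Locality of the Levi-Civita connection: `Literature/Geometry/Lorentzian/LeviCivitaLocality.lean`
(`PseudoRiemannianMetric.leviCivita_congr_nhds`, landed p136112 by this lead for this line). -/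

/-- **Gluing / locality of `IsLocalKilling`.**  If at every point of `W` the field `L` agrees, on an
open neighbourhood, with some local `T`-commuting Killing field, then `L` is a local `T`-commuting
Killing field on `W` (smoothness, the Killing equation and the bracket are all local in the germ of the
field). [folklore] -/
theorem IsLocalKilling.of_locally {W : Set 𝓑.carrier} {L : Π x : 𝓑.carrier, TangentSpace (𝓡 4) x}
    (h : ∀ x ∈ W, ∃ (O : Set 𝓑.carrier) (L₀ : Π x : 𝓑.carrier, TangentSpace (𝓡 4) x),
      IsOpen O ∧ x ∈ O ∧ IsLocalKilling 𝓑 O L₀ ∧ ∀ y ∈ O, L y = L₀ y) :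
    IsLocalKilling 𝓑 W L := by
  refine ⟨fun x hx ↦ ?_, fun x hx v w ↦ ?_, fun x hx ↦ ?_⟩
  · obtain ⟨O, L₀, hO, hxO, hL₀, hagree⟩ := h x hx
    have hOn : O ∈ 𝓝 x := hO.mem_nhds hxO
    have hev : (fun y ↦ (Bundle.TotalSpace.mk' E4 y (L y) : TangentBundle (𝓡 4) 𝓑.carrier)) =ᶠ[𝓝 x]
        (fun y ↦ (Bundle.TotalSpace.mk' E4 y (L₀ y) : TangentBundle (𝓡 4) 𝓑.carrier)) := by
      filter_upwards [hOn] with y hy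
      rw [hagree y hy]
    have h0 : ContMDiffAt (𝓡 4) ((𝓡 4).prod 𝓘(ℝ, E4)) ((⊤ : ℕ∞) : WithTop ℕ∞)
        (fun y ↦ (Bundle.TotalSpace.mk' E4 y (L₀ y) : TangentBundle (𝓡 4) 𝓑.carrier)) x :=
      (hL₀.1 x hxO).contMDiffAt hOn
    exact (h0.congr_of_eventuallyEq hev).contMDiffWithinAt
  · obtain ⟨O, L₀, hO, hxO, hL₀, hagree⟩ := h x hx
    have hev : L =ᶠ[𝓝 x] L₀ := by
      filter_upwards [hO.mem_nhds hxO] with y hy using hagree y hy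
    have hlc : 𝓑.metric.leviCivita L x = 𝓑.metric.leviCivita L₀ x :=
      PseudoRiemannianMetric.leviCivita_congr_nhds 𝓑.metric.toPseudoRiemannianMetric hev
    rw [hlc]
    exact hL₀.2.1 x hxO v w
  · obtain ⟨O, L₀, hO, hxO, hL₀, hagree⟩ := h x hx
    have hev : L =ᶠ[𝓝 x] L₀ := by
      filter_upwards [hO.mem_nhds hxO] with y hy using hagree y hy
    have : VectorField.mlieBracket (𝓡 4) 𝓑.killing L x = VectorField.mlieBracket (𝓡 4) 𝓑.killing L₀ x :=
      (EventuallyEq.rfl (f := 𝓑.killing)).mlieBracket_vectorField_eq hev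
    rw [this]
    exact hL₀.2.2 x hxO

/-- A local `T`-commuting Killing field on an OPEN set restricts, around each of its points, to itself
(the converse direction of `IsLocalKilling.of_locally`, used to re-base gluings). [folklore] -/
theorem IsLocalKilling.locally {W : Set 𝓑.carrier} {L : Π x : 𝓑.carrier, TangentSpace (𝓡 4) x}
    (hW : IsOpen W) (h : IsLocalKilling 𝓑 W L) :
    ∀ x ∈ W, ∃ (O : Set 𝓑.carrier) (L₀ : Π x : 𝓑.carrier, TangentSpace (𝓡 4) x),
      IsOpen O ∧ x ∈ O ∧ IsLocalKilling 𝓑 O L₀ ∧ ∀ y ∈ O, L y = L₀ y :=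
  fun x hx ↦ ⟨W, L, hW, hx, h, fun _ _ ↦ rfl⟩

/-- **A non-zero covector annihilating a timelike vector is the dual of a spacelike vector** (O'Neill
Lemma 5.26, in the tree as `LorentzianMetric.exists_pos_val_and_mfderiv_eq_val`): if `g(v, v) < 0`,
`dρ_x(v) = 0` and `dρ_x ≠ 0` then `dρ_x = g(w, ·)` with `g(w, w) > 0`. [cite: ONeill1983, Ch. 5, Lemma 5.26] -/
theorem spacelike_gradient_of_annihilates_timelike {x : 𝓑.carrier} {ρ : 𝓑.carrier → ℝ}
    {v : TangentSpace (𝓡 4) x} (hv : 𝓑.metric.val x v v < 0) (h0 : mfderiv (𝓡 4) 𝓘(ℝ, ℝ) ρ x v = 0)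
    (hne : mfderiv (𝓡 4) 𝓘(ℝ, ℝ) ρ x ≠ 0) :
    ∃ w : TangentSpace (𝓡 4) x, 0 < 𝓑.metric.val x w w ∧
      ∀ u : TangentSpace (𝓡 4) x, mfderiv (𝓡 4) 𝓘(ℝ, ℝ) ρ x u = 𝓑.metric.val x w u :=
  𝓑.metric.exists_pos_val_and_mfderiv_eq_val (T := fun _ ↦ v) hv h0 hne

/-- An adapted two-variable analytic chart is in particular a two-variable analytic chart. [folklore] -/
theorem TwoVariableAnalyticAdaptedAt.twoVariableAnalyticAt {ρ : 𝓑.carrier → ℝ} {q : 𝓑.carrier}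
    (h : TwoVariableAnalyticAdaptedAt 𝓑 ρ q) : TwoVariableAnalyticAt 𝓑 q := by
  obtain ⟨ψ, hψ, hq, htl, -, -, hcauchy⟩ := h
  exact ⟨ψ, hψ, hq, htl, hcauchy⟩

/-- **The former bet is a consequence of the adapted engine**: at a point with an adapted two-variable analytic
chart and `dρ ≠ 0`, the gradient of `ρ` is spacelike (the level set of `ρ` is a timelike hypersurface).
[cite: ONeill1983, Ch. 5, Lemma 5.26] -/
theorem TwoVariableAnalyticAdaptedAt.spacelike_gradient {ρ : 𝓑.carrier → ℝ} {q : 𝓑.carrier}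
    (h : TwoVariableAnalyticAdaptedAt 𝓑 ρ q) (hne : mfderiv (𝓡 4) 𝓘(ℝ, ℝ) ρ q ≠ 0) :
    ∃ w : TangentSpace (𝓡 4) q, 0 < 𝓑.metric.val q w w ∧
      ∀ u : TangentSpace (𝓡 4) q, mfderiv (𝓡 4) 𝓘(ℝ, ℝ) ρ q u = 𝓑.metric.val q w u := by
  obtain ⟨ψ, -, -, ⟨a, b, hab⟩, h0, h1, -⟩ := h
  refine spacelike_gradient_of_annihilates_timelike hab ?_ hne
  -- all tangent spaces are `E4` definitionally: compute with the Fréchet derivative as a map on `E4`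
  set L : E4 →L[ℝ] ℝ := mfderiv (𝓡 4) 𝓘(ℝ, ℝ) ρ q with hL
  set X0 : E4 := mfderiv 𝓘(ℝ, E4) (𝓡 4) ψ.symm (ψ q) (EuclideanSpace.single 0 1) with hX0
  set X1 : E4 := mfderiv 𝓘(ℝ, E4) (𝓡 4) ψ.symm (ψ q) (EuclideanSpace.single 1 1) with hX1
  change L (a • X0 + b • X1) = 0
  change L X0 = 0 at h0
  change L X1 = 0 at h1
  rw [L.map_add, L.map_smul, L.map_smul, h0, h1, smul_zero, smul_zero, add_zero]

/-! ### Unique continuation of Killing fields on connected open sets (manifold form; for S1a, S2, S3)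

Built on the tree's patching on immersed chart images (`stub_isKillingFieldOn_patching`, crux GapExhaustion,
landed) by an open–closed argument through charts of the maximal atlas; the first two clauses of
`IsLocalKilling` ARE `PseudoRiemannianMetric.IsKillingFieldOn`. -/

/-- **Unique continuation of Killing fields on a connected open set.**  For a spacetime `𝓢` and two
Killing fields `K₁, K₂` of `g` on a connected open `W` (`IsKillingFieldOn`: smooth on `W` + Killing
equation on `W`) which agree on a non-empty open `O ⊆ W`: `K₁ = K₂` on `W`.  Proof: the set of points of
`W` near which the fields agree is open, non-empty, and closed in `W` — at a point of its closure, read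
both fields through a chart of the maximal atlas on a coordinate ball (connected) and apply the tree's
patching on immersed chart images (`stub_isKillingFieldOn_patching`). O'Neill 1983, Ch. 9, Lemma 9.28;
Kobayashi–Nomizu I, Ch. VI, Thm. 3.3. [cite: ONeill1983, Ch. 9, Lemma 9.28] -/
theorem isKillingFieldOn_eqOn_of_isConnected (𝓢 : Spacetime.{0} 4) [𝓢.metric.HasLeviCivita]
    {W O : Set 𝓢.carrier} {K₁ K₂ : Π x : 𝓢.carrier, TangentSpace (𝓡 4) x}
    (hW : IsOpen W) (hWc : IsConnected W) (hO : IsOpen O) (hOW : O ⊆ W) (hOne : O.Nonempty)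
    (h₁ : 𝓢.metric.toPseudoRiemannianMetric.IsKillingFieldOn K₁ W)
    (h₂ : 𝓢.metric.toPseudoRiemannianMetric.IsKillingFieldOn K₂ W)
    (hag : ∀ x ∈ O, K₁ x = K₂ x) : ∀ x ∈ W, K₁ x = K₂ x := by
  -- `Z` = points of `W` with a neighbourhood (inside `W`) on which the fields agree
  set Z : Set 𝓢.carrier := {x | ∃ V : Set 𝓢.carrier, IsOpen V ∧ x ∈ V ∧ V ⊆ W ∧ ∀ y ∈ V, K₁ y = K₂ y}
    with hZ
  have hZopen : IsOpen Z := by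
    rw [isOpen_iff_forall_mem_open]
    rintro x ⟨V, hV, hxV, hVW, hVag⟩
    exact ⟨V, fun y hy ↦ ⟨V, hV, hy, hVW, hVag⟩, hV, hxV⟩
  have hZW : Z ⊆ W := by rintro x ⟨V, -, hxV, hVW, -⟩; exact hVW hxV
  have hZne : (W ∩ Z).Nonempty := by
    obtain ⟨x, hx⟩ := hOne
    exact ⟨x, hOW hx, O, hO, hx, hOW, hag⟩
  -- closedness in `W`: the chart step
  have hclosed : closure Z ∩ W ⊆ Z := by
    rintro x ⟨hxcl, hxW⟩
    -- chart at `x`, and a coordinate ball inside the image of `W ∩ source`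
    set e := chartAt E4 x with he
    have hemax : e ∈ IsManifold.maximalAtlas (𝓡 4) ∞ 𝓢.carrier := IsManifold.chart_mem_maximalAtlas x
    have hxs : x ∈ e.source := mem_chart_source E4 x
    have hopen : IsOpen (e.target ∩ e.symm ⁻¹' W) :=
      e.continuousOn_symm.isOpen_inter_preimage e.open_target hW
    have hex : e x ∈ e.target ∩ e.symm ⁻¹' W :=
      ⟨e.map_source hxs, by simp only [mem_preimage, e.left_inv hxs]; exact hxW⟩
    obtain ⟨r, hr, hball⟩ := Metric.isOpen_iff.mp hopen (e x) hex
    set B : Set E4 := Metric.ball (e x) r with hB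
    have hBt : B ⊆ e.target := fun p hp ↦ (hball hp).1
    have hBW : e.symm '' B ⊆ W := by rintro _ ⟨p, hp, rfl⟩; exact (hball hp).2
    -- the immersed chart `Ψ := e.symm` on `B`
    have hΨ : ContMDiffOn 𝓘(ℝ, E4) (𝓡 4) ∞ e.symm B :=
      (contMDiffOn_symm_of_mem_maximalAtlas hemax).mono hBt
    have hinj : ∀ y ∈ B, Function.Injective (mfderiv 𝓘(ℝ, E4) (𝓡 4) e.symm y) := fun y hy ↦
      (mdifferentiable_chart (I := 𝓡 4) x).symm.mfderiv_injective (hBt hy)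
    -- a point of `Z` inside `e.symm '' B` (since `x ∈ closure Z` and `e.symm '' B` is a neighbourhood of `x`)
    have hnbhd : e.symm '' B ∈ 𝓝 x := by
      have : e.source ∩ e ⁻¹' B ∈ 𝓝 x := by
        apply (e.continuousOn.isOpen_inter_preimage e.open_source Metric.isOpen_ball).mem_nhds
        exact ⟨hxs, Metric.mem_ball_self hr⟩
      refine Filter.mem_of_superset this ?_
      rintro y ⟨hys, hyB⟩
      exact ⟨e y, hyB, e.left_inv hys⟩
    obtain ⟨z, hzB, hzZ⟩ : (e.symm '' B ∩ Z).Nonempty := mem_closure_iff_nhds.mp hxcl _ hnbhd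
    obtain ⟨V, hV, hzV, -, hVag⟩ := hzZ
    -- `U := B ∩ e.symm ⁻¹' V`, non-empty open, where the pulled-back fields agree
    set U : Set E4 := B ∩ e.symm ⁻¹' V with hU
    have hUopen : IsOpen U := by
      have h' : IsOpen (e.target ∩ e.symm ⁻¹' V) := e.continuousOn_symm.isOpen_inter_preimage e.open_target hV
      have : U = B ∩ (e.target ∩ e.symm ⁻¹' V) := by
        ext p; constructor
        · rintro ⟨hpB, hpV⟩; exact ⟨hpB, hBt hpB, hpV⟩
        · rintro ⟨hpB, -, hpV⟩; exact ⟨hpB, hpV⟩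
      rw [this]; exact Metric.isOpen_ball.inter h'
    have hUne : U.Nonempty := by
      obtain ⟨p, hpB, rfl⟩ := hzB
      exact ⟨p, hpB, hzV⟩
    have hpatch := Summit.FinalStateConjecture.FinalStateConjecture.Theorems.stub_isKillingFieldOn_patching 𝓢 e.symm B U
      K₁ K₂ Metric.isOpen_ball
      ((Metric.isPathConnected_ball hr).isConnected) hUopen inter_subset_left hUne hΨ hinj (h₁.mono hBW)
      (h₂.mono hBW)
      (fun p hp ↦ hVag _ hp.2)
    -- hence the fields agree on the neighbourhood `e.symm '' B` of `x`
    refine ⟨e.source ∩ e ⁻¹' B, e.continuousOn.isOpen_inter_preimage e.open_source Metric.isOpen_ball,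
      ⟨hxs, Metric.mem_ball_self hr⟩, ?_, ?_⟩
    · rintro y ⟨hys, hyB⟩
      exact hBW ⟨e y, hyB, e.left_inv hys⟩
    · rintro y ⟨hys, hyB⟩
      have := hpatch (e y) hyB
      rwa [e.left_inv hys] at this
  have hWZ : W ⊆ Z := hWc.isPreconnected.subset_of_closure_inter_subset hZopen hZne hclosed
  intro x hx
  obtain ⟨V, -, hxV, -, hVag⟩ := hWZ hx
  exact hVag x hxV

end Facts

/-! ## §3 Registered stubs (`sorry` ONLY here; shape `Holds.stub_<name>` + by-name handle)

The registered statements are written over LITERATURE VOCABULARY ONLY (the §1 predicates inlined), so that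
a stub landed under `Theorems/` with Literature imports alone matches the registered signature letter for
letter; `stub_<name>_iff` below reads each back in the §1 vocabulary (`Iff.rfl`). -/

namespace Holds

/-- **Stub S1a · invariantKillingSubcollar — a `T`-INVARIANT Killing sub-collar; size L (standard geometry,
infrastructure-blocked).**  Under the crux's binders: an open `U₁ ⊇ 𝓔⁺` whose trace `U₁ ∩ doc` is invariant
under the (whole-line) flow of `T`, containing `V ∩ doc` for an open `V` with `𝓔⁺ ⊆ V ⊆ U`, a local
`T`-commuting Killing field `K₁` on `U₁ ∩ doc`, and an open `U'' ⊇ 𝓔⁺` with `K₁ = K` on `U'' ∩ doc`.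
WHY NEEDED (wave-1 worker W1): `U' ∩ doc = {f < c₀} ∩ doc` in S1b is a union of `T`-orbits, and the crux's
`U` may be thin in Killing time at horizon points approached by `T`-timelike points of the d.o.c. (Kerr
poles: `U = {r < r₊ + ε e^{−t²}} ∪ {x ∈ doc | r < r₊ + δ, g(T,T) > −η e^{−t²}}` satisfies h6–h15), so
`K₀ := K` on a `T`-invariant sub-collar inside `U` is not available; the field must be TRANSPORTED.
PROOF INTENDED. Transport `K` by the stationary isometries `φₜ` (`StationaryAFBlackHole.exists_stationary_flow`)
from a radially convex neighbourhood of the connected horizon: (i) `φₜ^* K = K` while the orbit segment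
stays in `U` (flow form of `[T, K] = 0`); (ii) push-forwards of Killing fields by isometries are Killing
(`ConnectionNaturality.lean` has the connection half); (iii) one-jet rigidity of Killing fields on connected
open sets (`KillingOpensJetRigidity.lean`, chart form) for consistency of overlapping transports; (iv) a
neighbourhood basis of `𝓔⁺` by sets `W` with `W ∩ φ₋ₛ(W)` connected (Lipschitz achronal boundary,
Hawking–Ellis Prop. 6.3.1 / CC08 §4.1).  Disproof (F7).4: this is the disprover's "WLOG `T`-invariant collar
needs 1-jet rigidity along `𝓔⁺`", taken as an explicit burden.  WHY IT MIGHT FAIL. Only by missing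
infrastructure (i)–(iv).  REV 3.4 (wave-2 worker W4's analysis): (i) flow form of `[T,K]=0`
(`CommutingFlowLocal.lean`), (ii) naturality (`KillingFieldOnNaturality.lean`), transported fields
(`FlowTransportedField.lean`) are LANDED; (iii)–(iv) are replaced by a CANONICAL transport — from the slice
of the Chruściel–Costa EQUIVARIANT TIME FUNCTION `t` (Thm. 4.5: smooth on the d.o.c., continuous up to `𝓔⁺`,
`t ∘ φₛ = t + s`), now the FIRST HYPOTHESIS of the stub (discharged by stub S1c = the Literature named fact
`chruscielCosta2008_equivariantTimeFunction`): `K₁(y) := dφ_{t(y)} K(φ_{−t(y)} y)` on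
`U₁ ∩ doc := {y ∈ doc | φ_{−t(y)} y ∈ U}` (open, flow-invariant), `= K` near `𝓔⁺` because the orbit
segment back to the slice stays in `U` there (continuity of `t` at horizon points, `φₛ(𝓔⁺) = 𝓔⁺ ⊆ U`,
tube lemma), and locally `K₁ = (φ_{s₀})_* K` — Killing, smooth, `T`-commuting by (ii).
[cite: ChruscielCosta2008, §2.2, §4.1 and Thm. 4.5] [cite: ONeill1983, Ch. 9, Lemma 9.28] -/
theorem stub_invariantKillingSubcollar :
    chruscielCosta2008_equivariantTimeFunction →
    ∀ (𝓑 : StationaryAFBlackHole.{0}) [𝓑.metric.HasLeviCivita],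
      𝓑.metric.toPseudoRiemannianMetric.IsRicciFlat → 𝓑.IsIPlusRegular →
      (∀ p : 𝓑.carrier, p ∈ 𝓑.metric.chronologicalFuture 𝓑.timeOrientation 𝓑.Mext) →
      (∀ p ∈ 𝓑.doc, 𝓑.killing p ≠ 0) → SimplyConnectedSpace 𝓑.doc →
      ∀ (U : Set 𝓑.carrier) (K : Π x : 𝓑.carrier, TangentSpace (𝓡 4) x), IsOpen U → 𝓑.horizon ⊆ U →
      IsConnected 𝓑.horizon →
      ContMDiffOn (𝓡 4) ((𝓡 4).prod 𝓘(ℝ, E4)) ((⊤ : ℕ∞) : WithTop ℕ∞)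
        (fun x ↦ (Bundle.TotalSpace.mk' E4 x (K x) : TangentBundle (𝓡 4) 𝓑.carrier)) U →
      (∀ x ∈ U, ∀ v w : TangentSpace (𝓡 4) x,
        𝓑.metric.val x (𝓑.metric.leviCivita K x v) w + 𝓑.metric.val x v (𝓑.metric.leviCivita K x w) = 0) →
      (∀ x ∈ U, VectorField.mlieBracket (𝓡 4) 𝓑.killing K x = 0) → (∀ p ∈ 𝓑.horizon, K p ≠ 0) →
      (∀ γ : ℝ → 𝓑.carrier, IsMIntegralCurve γ K → γ 0 ∈ 𝓑.horizon → ∀ t, γ t ∈ 𝓑.horizon) →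
      (∀ x ∈ U ∩ 𝓑.doc, 𝓑.metric.val x (K x) (K x) < 0) →
      (∃ S₀ : Set 𝓑.carrier, IsCompact S₀ ∧ S₀ ⊆ 𝓑.doc ∧ ∀ y ∈ 𝓑.doc,
        0 ≤ 𝓑.metric.val y (𝓑.killing y) (𝓑.killing y) → y ∉ U → y ∈ stationaryOrbit 𝓑.killing S₀) →
      (∀ S : Set 𝓑.carrier, IsCompact S → S ⊆ 𝓑.doc → ∀ (γ : ℝ → 𝓑.carrier) (s : Set ℝ),
        IsMaximalGeodesicOn 𝓑.metric.toPseudoRiemannianMetric.leviCivita γ s → s.Nonempty →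
        (∀ t ∈ s, 𝓑.metric.val (γ t) (velocity (𝓡 4) γ t) (velocity (𝓡 4) γ t) = 0 ∧
          velocity (𝓡 4) γ t ≠ 0 ∧ 𝓑.metric.val (γ t) (velocity (𝓡 4) γ t) (𝓑.killing (γ t)) = 0) →
        ∃ t ∈ s, γ t ∉ stationaryOrbit 𝓑.killing S) →
      ∃ (U₁ V U'' : Set 𝓑.carrier) (K₁ : Π x : 𝓑.carrier, TangentSpace (𝓡 4) x),
        IsOpen U₁ ∧ 𝓑.horizon ⊆ U₁ ∧
        (∀ γ : ℝ → 𝓑.carrier, IsMIntegralCurve γ 𝓑.killing → γ 0 ∈ U₁ ∩ 𝓑.doc →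
          ∀ t, γ t ∈ U₁ ∩ 𝓑.doc) ∧
        IsOpen V ∧ 𝓑.horizon ⊆ V ∧ V ⊆ U ∧ V ∩ 𝓑.doc ⊆ U₁ ∧
        (ContMDiffOn (𝓡 4) ((𝓡 4).prod 𝓘(ℝ, E4)) ((⊤ : ℕ∞) : WithTop ℕ∞)
            (fun x ↦ (Bundle.TotalSpace.mk' E4 x (K₁ x) : TangentBundle (𝓡 4) 𝓑.carrier)) (U₁ ∩ 𝓑.doc) ∧
          (∀ x ∈ (U₁ ∩ 𝓑.doc), ∀ v w : TangentSpace (𝓡 4) x,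
            𝓑.metric.val x (𝓑.metric.leviCivita K₁ x v) w +
              𝓑.metric.val x v (𝓑.metric.leviCivita K₁ x w) = 0) ∧
          ∀ x ∈ (U₁ ∩ 𝓑.doc), VectorField.mlieBracket (𝓡 4) 𝓑.killing K₁ x = 0) ∧
        IsOpen U'' ∧ 𝓑.horizon ⊆ U'' ∧ ∀ x ∈ U'' ∩ 𝓑.doc, K₁ x = K x :=
  Summit.FinalStateConjecture.FinalStateConjecture.Theorems.NonTrappingHawkingRigidity.AzimuthalPartialAnalyticity.stub_invariantKillingSubcollar

/-- **Stub S1b · invariantRadialFunction — STRUCTURE OF THE D.O.C. (rev 4: the former bet is gone, absorbed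
into the adapted engine S4b); literature level, size L–XL as a formalization.**  For every vacuum, `I⁺`-regular,
future-presented `𝓑` with `T ≠ 0` on a simply connected d.o.c. and connected horizon (binders h1–h5, h8): there
is a `T`-INVARIANT RADIAL FUNCTION `ρ` of the d.o.c. adapted to the horizon — (R1) smooth on the d.o.c., (R2)
`dρ(T) = 0`, (R3) `dρ ≠ 0`, (R4) sub-levels `{ρ < c}` are traces of open neighbourhoods of `𝓔⁺`, (R5) thin below
every flow-invariant open neighbourhood of `𝓔⁺`, (R6) slabs compact modulo `T` (`IsInvariantRadialFunction`, §1).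
NOTHING is asked of the causal character of `dρ` (that is now part of the engine's output, stub S4b
`stub_adaptedAnalyticSweep`).  PROOF IN PRINT: `ρ` is the `[0, ∞)`-coordinate of `S̄₀ ≈ S² × [0, ∞)` lifted along
`⟨⟨M_ext⟩⟩ ∪ 𝓔⁺ ≈ ℝ × S̄₀` — Chruściel–Costa 2008, Thm. 4.5 (product structure WITH ergoregion; the tree has it only
for `T` timelike on the whole d.o.c., `IsIPlusRegular.exists_docTrivialization`, and its time-function part as the
named fact `chruscielCosta2008_equivariantTimeFunction`), Cor. 2.4–2.5 / §4.1 (`∂S̄₀` is a compact connected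
cross-section — `𝓔⁺` connected, h8), topological censorship (simple connectivity of the d.o.c., h5, passes to
`S̄₀`: Galloway 1995 / Chruściel–Wald 1994) and the Poincaré conjecture (a simply connected 3-manifold with one
`S²` boundary component and one asymptotically flat end is `S² × [0, ∞)`).  On Kerr `ρ = r − r₊`.  WHY IT MIGHT
FAIL. Only as a formalization debt (3-manifold topology). [cite: ChruscielCosta2008, Thm. 4.5 and §4.1]
[cite: ChruscielWald1994, Thm. 1] -/
theorem stub_invariantRadialFunction :
    ∀ (𝓑 : StationaryAFBlackHole.{0}) [𝓑.metric.HasLeviCivita],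
      𝓑.metric.toPseudoRiemannianMetric.IsRicciFlat → 𝓑.IsIPlusRegular →
      (∀ p : 𝓑.carrier, p ∈ 𝓑.metric.chronologicalFuture 𝓑.timeOrientation 𝓑.Mext) →
      (∀ p ∈ 𝓑.doc, 𝓑.killing p ≠ 0) → SimplyConnectedSpace 𝓑.doc → IsConnected 𝓑.horizon →
      ∃ ρ : 𝓑.carrier → ℝ,
        ContMDiffOn (𝓡 4) 𝓘(ℝ, ℝ) ((⊤ : ℕ∞) : WithTop ℕ∞) ρ 𝓑.doc ∧
        (∀ x ∈ 𝓑.doc, mfderiv (𝓡 4) 𝓘(ℝ, ℝ) ρ x (𝓑.killing x) = 0) ∧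
        (∀ x ∈ 𝓑.doc, mfderiv (𝓡 4) 𝓘(ℝ, ℝ) ρ x ≠ 0) ∧
        (∀ c : ℝ, 0 < c → ∃ U' : Set 𝓑.carrier, IsOpen U' ∧ 𝓑.horizon ⊆ U' ∧
          U' ∩ 𝓑.doc = {x | x ∈ 𝓑.doc ∧ ρ x < c}) ∧
        (∀ U₁ : Set 𝓑.carrier, IsOpen U₁ → 𝓑.horizon ⊆ U₁ →
          (∀ γ : ℝ → 𝓑.carrier, IsMIntegralCurve γ 𝓑.killing → γ 0 ∈ U₁ ∩ 𝓑.doc →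
            ∀ t, γ t ∈ U₁ ∩ 𝓑.doc) →
          ∃ c : ℝ, 0 < c ∧ {x | x ∈ 𝓑.doc ∧ ρ x < c} ⊆ U₁) ∧
        (∀ c₀ c : ℝ, 0 < c₀ → ∃ S : Set 𝓑.carrier, IsCompact S ∧ S ⊆ 𝓑.doc ∧
          {x | x ∈ 𝓑.doc ∧ c₀ ≤ ρ x ∧ ρ x ≤ c} ⊆ stationaryOrbit 𝓑.killing S) := by
  sorry

/-- **Stub S2 · pointContinuation — THE IN-PRINT LEVER: Killing continuation across a NON-NULL
hypersurface under TWO-VARIABLE ANALYTICITY; size L–XL.**  In a Ricci-flat `𝓑`, let `L` be a local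
`T`-commuting Killing field on an open `D ⊆ doc`, let `q ∈ doc`, let `D` contain the strict sub-level
side near `q` of a function `f` smooth near `q` with NON-NULL gradient at `q` (`NonNullSupportAt`), and let
the metric be two-variable analytic at `q` (`TwoVariableAnalyticAt`: a chart around `q` with timelike
coordinate 2-plane `span{∂₀, ∂₁}` at `q` in which the components extend holomorphically in `(z⁰, z¹)`,
jointly smoothly).  Then `(D, L)` has a one-step continuation at `q`: an open `W ∋ q` in the d.o.c. and a
local `T`-commuting Killing field `L'` on `W` with `L' = L` on `W ∩ D`.
PROOF IN PRINT (the engine) + ROUTINE (the system).  Unique continuation across the non-characteristic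
hypersurface `{f = f q}` at `q` for second-order operators with real principal symbol `g^{μν}ξ_μξ_ν ⊗ Id`
whose coefficients are `C^∞` and analytic in `x_a = (x⁰, x¹)`: Tataru, JMPA 78 (1999) Thm 1;
Robbiano–Zuily, Invent. Math. 131 (1998) Thm A; Hörmander, PNLDE 32 (1997) Thm 1 (quantitative:
Laurent–Léautaud, JEMS 21 (2019)) — the pseudo-convexity hypothesis is required only on the residual set
`Γ_q = Char ∩ {ξ(∂₀) = ξ(∂₁) = 0}`, which is EMPTY because `span{∂₀, ∂₁}` is timelike at `q` (a null
covector annihilating a timelike 2-plane is zero: `SketchIdeator1.orthogonalOfTimelikePlaneIsSpacelike_holds`),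
and non-characteristicity is `g⁻¹(df, df) = g(n, n) ≠ 0`.  Applied to the Ionescu–Klainerman
Killing-extension system for `(L; π = 𝓛_L g, W = 𝓛_L Riem)` (JAMS 26 (2013) = arXiv:1108.3575 §2 and
AIK CMP 299 (2010) §4: `□_g W = 𝓜(W, ∇W, π, ∇π)`, transport equations for `π` along the geodesics from the
known side, all coefficients built from `g`, hence two-variable analytic in the same chart), whose unknowns
vanish on the known side `{f < f q} ∩ N ∩ doc ⊆ D`; the extended `L` (defined by the IK Jacobi-type
transport) is then Killing near `q`, `[T, L']` is Killing on `W` and vanishes on the known side, hence on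
the connected `W` (one-jet uniqueness, `KillingOpensJetRigidity.lean` pattern); shrink `W` into the open
d.o.c.  WHY IT MIGHT FAIL. Transcription risk W7 of the card: Tataru/RZ/H are stated for (systems with)
scalar real principal part; the IK system couples a wave part with a TRANSPORT part, for which the
partially-analytic Carleman weight must be re-derived (IK's own Carleman pair, Prop. 3.3 of
arXiv:0711.0040 + Lemma A.3 of AIK 2010a, is pseudo-convexity-based) — not verbatim in print; the
scalar model (`SketchIdeator1.TwoKillingNonNullContinuation`) is.
[cite: Tataru1999PartiallyAnalytic, Thm. 1] [cite: RobbianoZuily1998, Thm. A] [cite: Hormander1997PartialAnalyticity, Thm. 1]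
[cite: IonescuKlainerman2012, Thm. 1.2 and §2] [cite: AlexakisIonescuKlainerman2009, §4] -/
theorem stub_pointContinuation :
    ∀ (𝓑 : StationaryAFBlackHole.{0}) [𝓑.metric.HasLeviCivita],
      𝓑.metric.toPseudoRiemannianMetric.IsRicciFlat →
      ∀ (D : Set 𝓑.carrier) (L : Π x : 𝓑.carrier, TangentSpace (𝓡 4) x), IsOpen D → D ⊆ 𝓑.doc →
      (ContMDiffOn (𝓡 4) ((𝓡 4).prod 𝓘(ℝ, E4)) ((⊤ : ℕ∞) : WithTop ℕ∞)
          (fun x ↦ (Bundle.TotalSpace.mk' E4 x (L x) : TangentBundle (𝓡 4) 𝓑.carrier)) D ∧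
        (∀ x ∈ D, ∀ v w : TangentSpace (𝓡 4) x,
          𝓑.metric.val x (𝓑.metric.leviCivita L x v) w + 𝓑.metric.val x v (𝓑.metric.leviCivita L x w) = 0) ∧
        ∀ x ∈ D, VectorField.mlieBracket (𝓡 4) 𝓑.killing L x = 0) →
      ∀ q ∈ 𝓑.doc, ∀ f : 𝓑.carrier → ℝ,
      (∃ N : Set 𝓑.carrier, IsOpen N ∧ q ∈ N ∧
        ContMDiffOn (𝓡 4) 𝓘(ℝ, ℝ) ((⊤ : ℕ∞) : WithTop ℕ∞) f N ∧
        (∃ nq : TangentSpace (𝓡 4) q, 𝓑.metric.val q nq nq ≠ 0 ∧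
          ∀ w : TangentSpace (𝓡 4) q, mfderiv (𝓡 4) 𝓘(ℝ, ℝ) f q w = 𝓑.metric.val q nq w) ∧
        ∀ x ∈ N ∩ 𝓑.doc, x ∈ D ↔ f x < f q) →
      (∃ ψ ∈ IsManifold.maximalAtlas (𝓡 4) ((⊤ : ℕ∞) : WithTop ℕ∞) 𝓑.carrier, q ∈ ψ.source ∧
        (∃ a b : ℝ, 𝓑.metric.val q
            (a • mfderiv 𝓘(ℝ, E4) (𝓡 4) ψ.symm (ψ q) (EuclideanSpace.single 0 1) +
              b • mfderiv 𝓘(ℝ, E4) (𝓡 4) ψ.symm (ψ q) (EuclideanSpace.single 1 1))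
            (a • mfderiv 𝓘(ℝ, E4) (𝓡 4) ψ.symm (ψ q) (EuclideanSpace.single 0 1) +
              b • mfderiv 𝓘(ℝ, E4) (𝓡 4) ψ.symm (ψ q) (EuclideanSpace.single 1 1)) < 0) ∧
        ∀ a b : E4, ∃ δ > (0 : ℝ), ∃ M C : ℝ, 0 ≤ M ∧ 0 ≤ C ∧ Metric.ball (ψ q) δ ⊆ ψ.target ∧
          ContDiffOn ℝ ((⊤ : ℕ∞) : WithTop ℕ∞)
            (fun p : E4 ↦ 𝓑.metric.val (ψ.symm p) (mfderiv 𝓘(ℝ, E4) (𝓡 4) ψ.symm p a) (mfderiv 𝓘(ℝ, E4) (𝓡 4) ψ.symm p b)) (Metric.ball (ψ q) δ) ∧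
          ∀ z ∈ Metric.ball (ψ q) δ, ∀ (k : ℕ) (v : Fin k → E4),
            (∀ i, v i = EuclideanSpace.single 0 1 ∨ v i = EuclideanSpace.single 1 1) →
            ‖iteratedFDeriv ℝ k
                (fun p : E4 ↦ 𝓑.metric.val (ψ.symm p) (mfderiv 𝓘(ℝ, E4) (𝓡 4) ψ.symm p a) (mfderiv 𝓘(ℝ, E4) (𝓡 4) ψ.symm p b)) z v‖ ≤ M * C ^ k * k !) →
      (∃ (W : Set 𝓑.carrier) (L' : Π x : 𝓑.carrier, TangentSpace (𝓡 4) x),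
        IsOpen W ∧ q ∈ W ∧ W ⊆ 𝓑.doc ∧
        (ContMDiffOn (𝓡 4) ((𝓡 4).prod 𝓘(ℝ, E4)) ((⊤ : ℕ∞) : WithTop ℕ∞)
            (fun x ↦ (Bundle.TotalSpace.mk' E4 x (L' x) : TangentBundle (𝓡 4) 𝓑.carrier)) W ∧
          (∀ x ∈ W, ∀ v w : TangentSpace (𝓡 4) x,
            𝓑.metric.val x (𝓑.metric.leviCivita L' x v) w + 𝓑.metric.val x v (𝓑.metric.leviCivita L' x w) = 0) ∧
          ∀ x ∈ W, VectorField.mlieBracket (𝓡 4) 𝓑.killing L' x = 0) ∧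
        ∀ x ∈ W ∩ D, L' x = L x) := by
  sorry

/-- **Stub S3 · slabPatching — pointwise continuations along a level of the sweep patch to a uniform
slab; size L (differential topology, provable in principle).**  Let `f` be a timelike sweep off `U'`
with bottom level `c₀` (`IsTimelikeSweep`) of an `I⁺`-regular `𝓑`, `c ≥ c₀`, and `L` a local
`T`-commuting Killing field on the sub-level set `{f < c} ∩ doc`.  If `({f < c} ∩ doc, L)` has a
one-step continuation at EVERY point of the level `{f = c} ∩ doc`, then there are `ε > 0` and ONE local
`T`-commuting Killing field `L'` on `{f < c + ε} ∩ doc` with `L' = L` on `{f < c} ∩ doc`.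
PROOF INTENDED. (1) Consistency: two continuations `(W_q, L_q)`, `(W_{q'}, L_{q'})` agree on every
connected component of `W_q ∩ W_{q'}` that meets the known side (their difference is Killing there and
vanishes on a non-empty open subset: one-jet rigidity, O'Neill Lemma 9.28 — in the tree for chart metrics,
`OpensChart.IsKillingField.eq_zero_of_oneJet_eq_zero`); shrinking each `W_q` to a box saturated by the
integral curves of `grad f` (flow-box of the non-vanishing gradient near the level; `df ≠ 0` there because
the gradient is spacelike) makes every component of every pairwise intersection meet `{f < c}` (follow the
gradient line down), so the `L_q` glue to one field near the level.  (2) Uniformity modulo `T`: the level is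
`T`-invariant and, by properness of the slab `{c₀ ≤ f ≤ c + 1}` modulo `T`, contained in the `T`-orbit of a
COMPACT subset `C` of itself; finitely many boxes cover `C`; the stationary isometries `φ_t` (complete `T`,
`I⁺`-regularity; `KillingFlowIsometry.lean`) transport boxes and fields (`f`, `doc` and — by `[T, L] = 0` on
the `T`-invariant domain — `L` are flow-invariant), and the complement of the glued domain in a compact
fundamental piece of the slab is compact with `f > c` on it, whence a uniform `ε`.  (3) If the level is
empty, properness gives `{f < c + ε} ∩ doc = {f < c} ∩ doc` for small `ε` and `L' = L`.  Smoothness /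
Killing / bracket of the glued field: `IsLocalKilling.of_locally`.  WHY IT MIGHT FAIL. Only by missing
infrastructure (flow-box theorem, global flows of complete vector fields as smooth isometric actions,
one-jet rigidity on an abstract manifold) — the statement is textbook.
[cite: ONeill1983, Ch. 9, Lemma 9.28 and Prop. 9.30] [cite: KobayashiNomizu1963, Ch. VI, Thm. 3.3]
[cite: ChruscielCosta2008, §4] -/
theorem stub_slabPatching :
    ∀ (𝓑 : StationaryAFBlackHole.{0}) [𝓑.metric.HasLeviCivita], 𝓑.IsIPlusRegular →
      ∀ (U' : Set 𝓑.carrier) (f : 𝓑.carrier → ℝ) (c₀ : ℝ),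
      (ContMDiffOn (𝓡 4) 𝓘(ℝ, ℝ) ((⊤ : ℕ∞) : WithTop ℕ∞) f 𝓑.doc ∧
        (∀ x ∈ 𝓑.doc, mfderiv (𝓡 4) 𝓘(ℝ, ℝ) f x (𝓑.killing x) = 0) ∧
        {x | x ∈ 𝓑.doc ∧ f x < c₀} = U' ∩ 𝓑.doc ∧
        (∀ x ∈ 𝓑.doc, c₀ ≤ f x → ∃ w : TangentSpace (𝓡 4) x, 0 < 𝓑.metric.val x w w ∧
          ∀ u : TangentSpace (𝓡 4) x, mfderiv (𝓡 4) 𝓘(ℝ, ℝ) f x u = 𝓑.metric.val x w u) ∧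
        ∀ c : ℝ, ∃ S : Set 𝓑.carrier, IsCompact S ∧ S ⊆ 𝓑.doc ∧
          {x | x ∈ 𝓑.doc ∧ c₀ ≤ f x ∧ f x ≤ c} ⊆ stationaryOrbit 𝓑.killing S) →
      ∀ c : ℝ, c₀ ≤ c → ∀ L : Π x : 𝓑.carrier, TangentSpace (𝓡 4) x,
      (ContMDiffOn (𝓡 4) ((𝓡 4).prod 𝓘(ℝ, E4)) ((⊤ : ℕ∞) : WithTop ℕ∞)
          (fun x ↦ (Bundle.TotalSpace.mk' E4 x (L x) : TangentBundle (𝓡 4) 𝓑.carrier)) {x | x ∈ 𝓑.doc ∧ f x < c} ∧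
        (∀ x ∈ {x | x ∈ 𝓑.doc ∧ f x < c}, ∀ v w : TangentSpace (𝓡 4) x,
          𝓑.metric.val x (𝓑.metric.leviCivita L x v) w + 𝓑.metric.val x v (𝓑.metric.leviCivita L x w) = 0) ∧
        ∀ x ∈ {x | x ∈ 𝓑.doc ∧ f x < c}, VectorField.mlieBracket (𝓡 4) 𝓑.killing L x = 0) →
      (∀ q ∈ 𝓑.doc, f q = c →
        (∃ (W : Set 𝓑.carrier) (L' : Π x : 𝓑.carrier, TangentSpace (𝓡 4) x),
          IsOpen W ∧ q ∈ W ∧ W ⊆ 𝓑.doc ∧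
          (ContMDiffOn (𝓡 4) ((𝓡 4).prod 𝓘(ℝ, E4)) ((⊤ : ℕ∞) : WithTop ℕ∞)
              (fun x ↦ (Bundle.TotalSpace.mk' E4 x (L' x) : TangentBundle (𝓡 4) 𝓑.carrier)) W ∧
            (∀ x ∈ W, ∀ v w : TangentSpace (𝓡 4) x,
              𝓑.metric.val x (𝓑.metric.leviCivita L' x v) w + 𝓑.metric.val x v (𝓑.metric.leviCivita L' x w) = 0) ∧
            ∀ x ∈ W, VectorField.mlieBracket (𝓡 4) 𝓑.killing L' x = 0) ∧
          ∀ x ∈ W ∩ {x | x ∈ 𝓑.doc ∧ f x < c}, L' x = L x)) →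
      ∃ ε : ℝ, 0 < ε ∧ ∃ L' : Π x : 𝓑.carrier, TangentSpace (𝓡 4) x,
        (ContMDiffOn (𝓡 4) ((𝓡 4).prod 𝓘(ℝ, E4)) ((⊤ : ℕ∞) : WithTop ℕ∞)
            (fun x ↦ (Bundle.TotalSpace.mk' E4 x (L' x) : TangentBundle (𝓡 4) 𝓑.carrier)) {x | x ∈ 𝓑.doc ∧ f x < c + ε} ∧
          (∀ x ∈ {x | x ∈ 𝓑.doc ∧ f x < c + ε}, ∀ v w : TangentSpace (𝓡 4) x,
            𝓑.metric.val x (𝓑.metric.leviCivita L' x v) w + 𝓑.metric.val x v (𝓑.metric.leviCivita L' x w) = 0) ∧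
          ∀ x ∈ {x | x ∈ 𝓑.doc ∧ f x < c + ε}, VectorField.mlieBracket (𝓡 4) 𝓑.killing L' x = 0) ∧
        ∀ x ∈ {x | x ∈ 𝓑.doc ∧ f x < c}, L' x = L x :=
  Summit.FinalStateConjecture.FinalStateConjecture.Theorems.NonTrappingHawkingRigidity.AzimuthalPartialAnalyticity.stub_slabPatching

/-- **Stub S4a · twoVariableAnalyticitySeeds — LANDED (p137190, wave-2 worker, 2026-08-17T01:55Z,
`Theorems/ZeroEnergyKerrOrBombNonTrappingHawkingRigidityStubTwoVariableAnalyticitySeeds.lean`) — the FREE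
part of the engine: two-variable analyticity where `T` is timelike and on the collar, from Müller zum
Hagen's theorem (an explicit HYPOTHESIS of this stub = the registered debt S4c).**  Under the
crux's binders, at every `q ∈ doc` with `g(T,T)(q) < 0` OR `q ∈ U`, the metric is two-variable analytic.
PROOF INTENDED. `mullerZumHagen1970_analytic_of_timelikeKilling` applied with `(U := univ, K := T)`
(`T` is smooth and Killing on the whole carrier: `𝓑.isStationaryKilling.isKillingField`) at a point where
`T` is timelike, resp. with the COLLAR pair `(U, K)` (smooth and Killing on `U` by h9–h10, timelike at
`q ∈ U ∩ doc` by h14), gives a chart `ψ` of the maximal smooth atlas around `q` with all components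
`AnalyticOnNhd ℝ` on `ψ.target`; (i) TILT: compose `ψ` with a linear automorphism `A` of `E4` sending
`dψ_q(v)` to `e₀` for a timelike `v` at `q` (components become `G_{A⁻¹a, A⁻¹b} ∘ A⁻¹`, still analytic;
the composite stays in the maximal atlas), so that `∂₀` is timelike at `q`; (ii) BOUNDS: the tree's
`AnalyticOnNhd.exists_ball_norm_iteratedFDeriv_le` (`Literature/Analysis/Calculus/AnalyticCauchyEstimates`)
gives `‖Dᵏ G(z)‖ ≤ M Cᵏ k!` on a ball, hence the directional bounds (‖eᵢ‖ = 1); smoothness of the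
components on the ball from analyticity.  WHY IT MIGHT FAIL. Only chart bookkeeping (maximal-atlas
membership of the tilted chart; `mfderiv` of `ψ.symm ∘ A⁻¹`). [cite: MullerZumHagen1970, Thm.]
[cite: KrantzParks2002, Prop. 2.2.10] -/
theorem stub_twoVariableAnalyticitySeeds :
    mullerZumHagen1970_analytic_of_timelikeKilling →
    ∀ (𝓑 : StationaryAFBlackHole.{0}) [𝓑.metric.HasLeviCivita],
      𝓑.metric.toPseudoRiemannianMetric.IsRicciFlat → 𝓑.IsIPlusRegular →
      (∀ p : 𝓑.carrier, p ∈ 𝓑.metric.chronologicalFuture 𝓑.timeOrientation 𝓑.Mext) →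
      (∀ p ∈ 𝓑.doc, 𝓑.killing p ≠ 0) → SimplyConnectedSpace 𝓑.doc →
      ∀ (U : Set 𝓑.carrier) (K : Π x : 𝓑.carrier, TangentSpace (𝓡 4) x), IsOpen U → 𝓑.horizon ⊆ U →
      IsConnected 𝓑.horizon →
      ContMDiffOn (𝓡 4) ((𝓡 4).prod 𝓘(ℝ, E4)) ((⊤ : ℕ∞) : WithTop ℕ∞)
        (fun x ↦ (Bundle.TotalSpace.mk' E4 x (K x) : TangentBundle (𝓡 4) 𝓑.carrier)) U →
      (∀ x ∈ U, ∀ v w : TangentSpace (𝓡 4) x,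
        𝓑.metric.val x (𝓑.metric.leviCivita K x v) w + 𝓑.metric.val x v (𝓑.metric.leviCivita K x w) = 0) →
      (∀ x ∈ U, VectorField.mlieBracket (𝓡 4) 𝓑.killing K x = 0) → (∀ p ∈ 𝓑.horizon, K p ≠ 0) →
      (∀ γ : ℝ → 𝓑.carrier, IsMIntegralCurve γ K → γ 0 ∈ 𝓑.horizon → ∀ t, γ t ∈ 𝓑.horizon) →
      (∀ x ∈ U ∩ 𝓑.doc, 𝓑.metric.val x (K x) (K x) < 0) →
      (∃ S₀ : Set 𝓑.carrier, IsCompact S₀ ∧ S₀ ⊆ 𝓑.doc ∧ ∀ y ∈ 𝓑.doc,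
        0 ≤ 𝓑.metric.val y (𝓑.killing y) (𝓑.killing y) → y ∉ U → y ∈ stationaryOrbit 𝓑.killing S₀) →
      (∀ S : Set 𝓑.carrier, IsCompact S → S ⊆ 𝓑.doc → ∀ (γ : ℝ → 𝓑.carrier) (s : Set ℝ),
        IsMaximalGeodesicOn 𝓑.metric.toPseudoRiemannianMetric.leviCivita γ s → s.Nonempty →
        (∀ t ∈ s, 𝓑.metric.val (γ t) (velocity (𝓡 4) γ t) (velocity (𝓡 4) γ t) = 0 ∧
          velocity (𝓡 4) γ t ≠ 0 ∧ 𝓑.metric.val (γ t) (velocity (𝓡 4) γ t) (𝓑.killing (γ t)) = 0) →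
        ∃ t ∈ s, γ t ∉ stationaryOrbit 𝓑.killing S) →
      ∀ q ∈ 𝓑.doc, (𝓑.metric.val q (𝓑.killing q) (𝓑.killing q) < 0 ∨ q ∈ U) →
      (∃ ψ ∈ IsManifold.maximalAtlas (𝓡 4) ((⊤ : ℕ∞) : WithTop ℕ∞) 𝓑.carrier, q ∈ ψ.source ∧
        (∃ a b : ℝ, 𝓑.metric.val q
            (a • mfderiv 𝓘(ℝ, E4) (𝓡 4) ψ.symm (ψ q) (EuclideanSpace.single 0 1) +
              b • mfderiv 𝓘(ℝ, E4) (𝓡 4) ψ.symm (ψ q) (EuclideanSpace.single 1 1))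
            (a • mfderiv 𝓘(ℝ, E4) (𝓡 4) ψ.symm (ψ q) (EuclideanSpace.single 0 1) +
              b • mfderiv 𝓘(ℝ, E4) (𝓡 4) ψ.symm (ψ q) (EuclideanSpace.single 1 1)) < 0) ∧
        ∀ a b : E4, ∃ δ > (0 : ℝ), ∃ M C : ℝ, 0 ≤ M ∧ 0 ≤ C ∧ Metric.ball (ψ q) δ ⊆ ψ.target ∧
          ContDiffOn ℝ ((⊤ : ℕ∞) : WithTop ℕ∞)
            (fun p : E4 ↦ 𝓑.metric.val (ψ.symm p) (mfderiv 𝓘(ℝ, E4) (𝓡 4) ψ.symm p a) (mfderiv 𝓘(ℝ, E4) (𝓡 4) ψ.symm p b)) (Metric.ball (ψ q) δ) ∧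
          ∀ z ∈ Metric.ball (ψ q) δ, ∀ (k : ℕ) (v : Fin k → E4),
            (∀ i, v i = EuclideanSpace.single 0 1 ∨ v i = EuclideanSpace.single 1 1) →
            ‖iteratedFDeriv ℝ k
                (fun p : E4 ↦ 𝓑.metric.val (ψ.symm p) (mfderiv 𝓘(ℝ, E4) (𝓡 4) ψ.symm p a) (mfderiv 𝓘(ℝ, E4) (𝓡 4) ψ.symm p b)) z v‖ ≤ M * C ^ k * k !) :=
  Summit.FinalStateConjecture.FinalStateConjecture.Theorems.NonTrappingHawkingRigidity.AzimuthalPartialAnalyticity.stub_twoVariableAnalyticitySeeds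

/-- **Stub S4b · adaptedAnalyticSweep — THE ENGINE C⁺ IN ADAPTED FORM (rev 4; replaces
`stub_twoVariableAnalyticityBelt`); open; size XL; the lead holds it.**  Under the crux's binders and GIVEN a radial
function `ρ₀` of the d.o.c. (stub S1b, structure only): there is a radial function `ρ` (same six structural
clauses — the prover may keep `ρ₀` or bend it in the belt) such that at every point `q` of the CLOSED ERGOREGION
`{g(T,T) ≥ 0} ∩ doc` the metric is two-variable analytic IN A CHART ADAPTED TO `ρ`: a chart `ψ` of the maximal
atlas around `q` whose coordinate plane `span{∂₀, ∂₁}` at `q` contains a timelike vector AND IS TANGENT TO THE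
LEVEL SET OF `ρ` (`dρ_q(∂₀) = dρ_q(∂₁) = 0`), with the uniform two-direction Cauchy estimates of
`TwoVariableAnalyticAt`.  WHY THIS SHAPE (lead, cycle 1, after the wave-3 landings): (i) the former bet of S1b
("`dρ` spacelike on the ergoregion") is a CONSEQUENCE — a non-zero covector annihilating a timelike vector is
the `g`-dual of a spacelike one (`exists_pos_val_and_mfderiv_eq_val`, O'Neill Lemma 5.26; §2
`spacelike_gradient_of_adapted`) — so the line no longer carries a free-floating geometric hypothesis; (ii) it is
what the card's mechanism produces anyway: the auxiliary analytic variable is an approximate axial angle `φ̂`, the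
analytic plane is `span{T, ∂_φ̂}` (timelike in the ergoregion, where `T + Ω ∂_φ̂` is timelike), and the sweep
function is the approximate Boyer–Lindquist radius, constant along both; (iii) corner-free fronts are forced: a
local sweep of a coordinate ball by non-null hyperplanes meets its own boundary sphere in corners at which the
known region is a wedge and no unique-continuation step applies, and closed fronts inside a ball always have null
conormals (Gauss map), so the fronts must be complete `T`-invariant hypersurfaces compact modulo `T` — level sets
of a global radial function — and their non-characteristicity where `T` is not timelike must come from the
analytic structure itself.  On Kerr: `ρ = r − r₊`, `ψ` = Boyer–Lindquist `(t, φ, r, θ)` off the axis (the belt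
`{g(T,T) ≥ 0} ∖ U` stays off the axis since the ergosurface meets the axis only on the horizon), components
independent of `(t, φ)`.  Inside the collar `U` the metric is fully analytic (Müller zum Hagen via the timelike
collar field `K`, S4a/S4c), so there the content is only that the levels of `ρ` are timelike hypersurfaces —
automatic for a `ρ` invariant under BOTH `T` and the timelike collar field `K` (a non-zero covector annihilating
a timelike vector is the dual of a spacelike one), e.g. the transport of a `K₁`-invariant germ along the
commuting flows; the whole content of the stub is therefore on the belt `{g(T,T) ≥ 0} ∩ doc ∖ U`.
Consumes h15 (belt compact mod `T`) and h16 (no trapping mod `T`) — the only place they enter.  WHY IT MIGHT FAIL: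
it is the open problem of the crux (non-trapping ⇒ hidden approximate axisymmetry with analytic dependence);
no theorem of this form exists. [cite: AlexakisIonescuKlainerman2010, §1] [cite: IonescuKlainerman2015, §4]
[cite: Tataru1999PartiallyAnalytic, Thm. 1] -/
theorem stub_adaptedAnalyticSweep :
    ∀ (𝓑 : StationaryAFBlackHole.{0}) [𝓑.metric.HasLeviCivita],
      𝓑.metric.toPseudoRiemannianMetric.IsRicciFlat → 𝓑.IsIPlusRegular →
      (∀ p : 𝓑.carrier, p ∈ 𝓑.metric.chronologicalFuture 𝓑.timeOrientation 𝓑.Mext) →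
      (∀ p ∈ 𝓑.doc, 𝓑.killing p ≠ 0) → SimplyConnectedSpace 𝓑.doc →
      ∀ (U : Set 𝓑.carrier) (K : Π x : 𝓑.carrier, TangentSpace (𝓡 4) x), IsOpen U → 𝓑.horizon ⊆ U →
      IsConnected 𝓑.horizon →
      ContMDiffOn (𝓡 4) ((𝓡 4).prod 𝓘(ℝ, E4)) ((⊤ : ℕ∞) : WithTop ℕ∞)
        (fun x ↦ (Bundle.TotalSpace.mk' E4 x (K x) : TangentBundle (𝓡 4) 𝓑.carrier)) U →
      (∀ x ∈ U, ∀ v w : TangentSpace (𝓡 4) x,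
        𝓑.metric.val x (𝓑.metric.leviCivita K x v) w + 𝓑.metric.val x v (𝓑.metric.leviCivita K x w) = 0) →
      (∀ x ∈ U, VectorField.mlieBracket (𝓡 4) 𝓑.killing K x = 0) → (∀ p ∈ 𝓑.horizon, K p ≠ 0) →
      (∀ γ : ℝ → 𝓑.carrier, IsMIntegralCurve γ K → γ 0 ∈ 𝓑.horizon → ∀ t, γ t ∈ 𝓑.horizon) →
      (∀ x ∈ U ∩ 𝓑.doc, 𝓑.metric.val x (K x) (K x) < 0) →
      (∃ S₀ : Set 𝓑.carrier, IsCompact S₀ ∧ S₀ ⊆ 𝓑.doc ∧ ∀ y ∈ 𝓑.doc,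
        0 ≤ 𝓑.metric.val y (𝓑.killing y) (𝓑.killing y) → y ∉ U → y ∈ stationaryOrbit 𝓑.killing S₀) →
      (∀ S : Set 𝓑.carrier, IsCompact S → S ⊆ 𝓑.doc → ∀ (γ : ℝ → 𝓑.carrier) (s : Set ℝ),
        IsMaximalGeodesicOn 𝓑.metric.toPseudoRiemannianMetric.leviCivita γ s → s.Nonempty →
        (∀ t ∈ s, 𝓑.metric.val (γ t) (velocity (𝓡 4) γ t) (velocity (𝓡 4) γ t) = 0 ∧
          velocity (𝓡 4) γ t ≠ 0 ∧ 𝓑.metric.val (γ t) (velocity (𝓡 4) γ t) (𝓑.killing (γ t)) = 0) →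
        ∃ t ∈ s, γ t ∉ stationaryOrbit 𝓑.killing S) →
      ∀ ρ₀ : 𝓑.carrier → ℝ,
      (ContMDiffOn (𝓡 4) 𝓘(ℝ, ℝ) ((⊤ : ℕ∞) : WithTop ℕ∞) ρ₀ 𝓑.doc ∧
        (∀ x ∈ 𝓑.doc, mfderiv (𝓡 4) 𝓘(ℝ, ℝ) ρ₀ x (𝓑.killing x) = 0) ∧
        (∀ x ∈ 𝓑.doc, mfderiv (𝓡 4) 𝓘(ℝ, ℝ) ρ₀ x ≠ 0) ∧
        (∀ c : ℝ, 0 < c → ∃ U' : Set 𝓑.carrier, IsOpen U' ∧ 𝓑.horizon ⊆ U' ∧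
          U' ∩ 𝓑.doc = {x | x ∈ 𝓑.doc ∧ ρ₀ x < c}) ∧
        (∀ U₁ : Set 𝓑.carrier, IsOpen U₁ → 𝓑.horizon ⊆ U₁ →
          (∀ γ : ℝ → 𝓑.carrier, IsMIntegralCurve γ 𝓑.killing → γ 0 ∈ U₁ ∩ 𝓑.doc →
            ∀ t, γ t ∈ U₁ ∩ 𝓑.doc) →
          ∃ c : ℝ, 0 < c ∧ {x | x ∈ 𝓑.doc ∧ ρ₀ x < c} ⊆ U₁) ∧
        (∀ c₀ c : ℝ, 0 < c₀ → ∃ S : Set 𝓑.carrier, IsCompact S ∧ S ⊆ 𝓑.doc ∧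
          {x | x ∈ 𝓑.doc ∧ c₀ ≤ ρ₀ x ∧ ρ₀ x ≤ c} ⊆ stationaryOrbit 𝓑.killing S)) →
      ∃ ρ : 𝓑.carrier → ℝ,
      (ContMDiffOn (𝓡 4) 𝓘(ℝ, ℝ) ((⊤ : ℕ∞) : WithTop ℕ∞) ρ 𝓑.doc ∧
        (∀ x ∈ 𝓑.doc, mfderiv (𝓡 4) 𝓘(ℝ, ℝ) ρ x (𝓑.killing x) = 0) ∧
        (∀ x ∈ 𝓑.doc, mfderiv (𝓡 4) 𝓘(ℝ, ℝ) ρ x ≠ 0) ∧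
        (∀ c : ℝ, 0 < c → ∃ U' : Set 𝓑.carrier, IsOpen U' ∧ 𝓑.horizon ⊆ U' ∧
          U' ∩ 𝓑.doc = {x | x ∈ 𝓑.doc ∧ ρ x < c}) ∧
        (∀ U₁ : Set 𝓑.carrier, IsOpen U₁ → 𝓑.horizon ⊆ U₁ →
          (∀ γ : ℝ → 𝓑.carrier, IsMIntegralCurve γ 𝓑.killing → γ 0 ∈ U₁ ∩ 𝓑.doc →
            ∀ t, γ t ∈ U₁ ∩ 𝓑.doc) →
          ∃ c : ℝ, 0 < c ∧ {x | x ∈ 𝓑.doc ∧ ρ x < c} ⊆ U₁) ∧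
        (∀ c₀ c : ℝ, 0 < c₀ → ∃ S : Set 𝓑.carrier, IsCompact S ∧ S ⊆ 𝓑.doc ∧
          {x | x ∈ 𝓑.doc ∧ c₀ ≤ ρ x ∧ ρ x ≤ c} ⊆ stationaryOrbit 𝓑.killing S)) ∧
      ∀ q ∈ 𝓑.doc, 0 ≤ 𝓑.metric.val q (𝓑.killing q) (𝓑.killing q) →
      (∃ ψ ∈ IsManifold.maximalAtlas (𝓡 4) ((⊤ : ℕ∞) : WithTop ℕ∞) 𝓑.carrier, q ∈ ψ.source ∧
        (∃ a b : ℝ, 𝓑.metric.val q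
            (a • mfderiv 𝓘(ℝ, E4) (𝓡 4) ψ.symm (ψ q) (EuclideanSpace.single 0 1) +
              b • mfderiv 𝓘(ℝ, E4) (𝓡 4) ψ.symm (ψ q) (EuclideanSpace.single 1 1))
            (a • mfderiv 𝓘(ℝ, E4) (𝓡 4) ψ.symm (ψ q) (EuclideanSpace.single 0 1) +
              b • mfderiv 𝓘(ℝ, E4) (𝓡 4) ψ.symm (ψ q) (EuclideanSpace.single 1 1)) < 0) ∧
        mfderiv (𝓡 4) 𝓘(ℝ, ℝ) ρ q (mfderiv 𝓘(ℝ, E4) (𝓡 4) ψ.symm (ψ q) (EuclideanSpace.single 0 1)) = 0 ∧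
        mfderiv (𝓡 4) 𝓘(ℝ, ℝ) ρ q (mfderiv 𝓘(ℝ, E4) (𝓡 4) ψ.symm (ψ q) (EuclideanSpace.single 1 1)) = 0 ∧
        ∀ a b : E4, ∃ δ > (0 : ℝ), ∃ M C : ℝ, 0 ≤ M ∧ 0 ≤ C ∧ Metric.ball (ψ q) δ ⊆ ψ.target ∧
          ContDiffOn ℝ ((⊤ : ℕ∞) : WithTop ℕ∞)
            (fun p : E4 ↦ 𝓑.metric.val (ψ.symm p) (mfderiv 𝓘(ℝ, E4) (𝓡 4) ψ.symm p a) (mfderiv 𝓘(ℝ, E4) (𝓡 4) ψ.symm p b)) (Metric.ball (ψ q) δ) ∧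
          ∀ z ∈ Metric.ball (ψ q) δ, ∀ (k : ℕ) (v : Fin k → E4),
            (∀ i, v i = EuclideanSpace.single 0 1 ∨ v i = EuclideanSpace.single 1 1) →
            ‖iteratedFDeriv ℝ k
                (fun p : E4 ↦ 𝓑.metric.val (ψ.symm p) (mfderiv 𝓘(ℝ, E4) (𝓡 4) ψ.symm p a) (mfderiv 𝓘(ℝ, E4) (𝓡 4) ψ.symm p b)) z v‖ ≤ M * C ^ k * k !) := by
  sorry

/-- **Stub S4c · mullerZumHagen — LITERATURE DEBT (named fact of the tree, unproved):** Müller zum Hagen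
1970 — a vacuum metric is real-analytic in harmonic coordinates near every point where a Killing field is
timelike (`Literature/Geometry/Lorentzian/MullerZumHagenAnalyticity.lean`,
`mullerZumHagen1970_analytic_of_timelikeKilling`; grounds AIE's `SeedsAtBothEnds`, stmt-13898).  Discharging
the fact (`_holds`, a literature-prover's job: Morrey/Friedman analyticity for analytic elliptic systems,
`Literature/Analysis/Calculus/AnalyticCauchyEstimates` + `AnalyticOfFDerivBound` are its first bricks) closes
this stub by `:= mullerZumHagen1970_analytic_of_timelikeKilling_holds`.  It is what lets the line honour
Disproof (F5): vacuum is consumed on `{g(T,T) < 0} ∖ U`. [cite: MullerZumHagen1970, Thm.]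
[cite: HawkingEllis1973, §9.3 p. 324] -/
theorem stub_mullerZumHagen : mullerZumHagen1970_analytic_of_timelikeKilling := by
  sorry

/-- **Stub S1c · docTimeFunction — LITERATURE DEBT (Chruściel–Costa 2008, Thm. 4.5, the structure theorem,
time-function part, `s = 1`); size L–XL.**  For an `I⁺`-regular `𝓑`: a function `t`, `C^∞` on the d.o.c.,
continuous on `doc ∪ 𝓔⁺ = closure ⟨⟨M_ext⟩⟩ ∩ I⁺(M_ext)`, with `t (γ s) = t (γ 0) + s` along every orbit of
`T` starting in `doc ∪ 𝓔⁺` — letter for letter the body of the Literature named fact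
`Literature.Geometry.Lorentzian.chruscielCosta2008_equivariantTimeFunction` (LANDED p138635,
`Literature/Geometry/Lorentzian/DocStructureTimeFunction.lean`; rev 3.5: stated BY NAME), so that its `_holds`
closes this stub by `:= chruscielCosta2008_equivariantTimeFunction_holds`.  The tree proves the strictly stationary case (`IsIPlusRegular.exists_docTimeFunction`, `T` timelike on
the whole d.o.c.); the general case is Prop. 4.6 (Wald's averaging) + the Lipschitz smoothing of §4.2.
[cite: ChruscielCosta2008, Thm. 4.5 and Prop. 4.6] -/
theorem stub_docTimeFunction : chruscielCosta2008_equivariantTimeFunction := by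
  sorry

end Holds

/-! ### By-name handles of the eight statements (no second copy of the text) -/

/-- Statement of registered stub S1a (`Holds.stub_invariantKillingSubcollar`), by name. -/
def stub_invariantKillingSubcollar : Prop := type_of% Holds.stub_invariantKillingSubcollar

/-- Statement of registered stub S1b (`Holds.stub_invariantRadialFunction`), by name. -/
def stub_invariantRadialFunction : Prop := type_of% Holds.stub_invariantRadialFunction

/-- Statement of registered stub S2 (`Holds.stub_pointContinuation`), by name. -/
def stub_pointContinuation : Prop := type_of% Holds.stub_pointContinuation

/-- Statement of registered stub S3 (`Holds.stub_slabPatching`), by name. -/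
def stub_slabPatching : Prop := type_of% Holds.stub_slabPatching

/-- Statement of registered stub S4a (`Holds.stub_twoVariableAnalyticitySeeds`), by name. -/
def stub_twoVariableAnalyticitySeeds : Prop := type_of% Holds.stub_twoVariableAnalyticitySeeds

/-- Statement of registered stub S4b (`Holds.stub_adaptedAnalyticSweep`), by name. -/
def stub_adaptedAnalyticSweep : Prop := type_of% Holds.stub_adaptedAnalyticSweep

/-- Statement of registered stub S4c (`Holds.stub_mullerZumHagen`), by name (it IS the Literature
constant `mullerZumHagen1970_analytic_of_timelikeKilling`). -/
def stub_mullerZumHagen : Prop := type_of% Holds.stub_mullerZumHagen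

/-- Statement of registered stub S1c (`Holds.stub_docTimeFunction`), by name (it IS the Literature
constant `chruscielCosta2008_equivariantTimeFunction`). -/
def stub_docTimeFunction : Prop := type_of% Holds.stub_docTimeFunction

/-! ### Read-backs: the registered (inlined) statements are the vocabulary forms, definitionally -/

section ReadBack

/-- **From a radial function with non-null levels off the sub-collar to the timelike sweep** (W5's
reduction, rev 4 form).  Given `ρ` with (R1)–(R6), the spacelike-gradient property on the closed ergoregion, and
an open `U₁ ⊇ 𝓔⁺` with flow-invariant trace: (R5) gives `c₀ > 0` with `{ρ < c₀} ∩ doc ⊆ U₁`; (R4) an open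
`U' ⊇ 𝓔⁺` with `U' ∩ doc = {ρ < c₀} ∩ doc`; take `f = ρ`; where `g(T,T) < 0`, `dρ(T) = 0` and `dρ ≠ 0` force a
spacelike gradient (`LorentzianMetric.exists_pos_val_and_mfderiv_eq_val`). [folklore] -/
theorem sweep_of_radial (𝓑 : StationaryAFBlackHole.{0}) {ρ : 𝓑.carrier → ℝ} (hρ : IsInvariantRadialFunction 𝓑 ρ)
    (hergo : ∀ x ∈ 𝓑.doc, 0 ≤ 𝓑.metric.val x (𝓑.killing x) (𝓑.killing x) →
      ∃ w : TangentSpace (𝓡 4) x, 0 < 𝓑.metric.val x w w ∧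
        ∀ u : TangentSpace (𝓡 4) x, mfderiv (𝓡 4) 𝓘(ℝ, ℝ) ρ x u = 𝓑.metric.val x w u)
    (U₁ : Set 𝓑.carrier) (hU₁ : IsOpen U₁) (hHU₁ : 𝓑.horizon ⊆ U₁)
    (hinv : ∀ γ : ℝ → 𝓑.carrier, IsMIntegralCurve γ 𝓑.killing → γ 0 ∈ U₁ ∩ 𝓑.doc →
      ∀ t, γ t ∈ U₁ ∩ 𝓑.doc) :
    ∃ (U' : Set 𝓑.carrier) (c₀ : ℝ),
      IsOpen U' ∧ 𝓑.horizon ⊆ U' ∧ U' ∩ 𝓑.doc ⊆ U₁ ∧ IsTimelikeSweep 𝓑 U' ρ c₀ := by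
  obtain ⟨hρs, hρT, hρreg, hadj, hthin, hslab⟩ := hρ
  obtain ⟨c₀, hc₀, hsub⟩ := hthin U₁ hU₁ hHU₁ hinv
  obtain ⟨U', hU'o, hU'H, hU'eq⟩ := hadj c₀ hc₀
  refine ⟨U', c₀, hU'o, hU'H, ?_, hρs, hρT, hU'eq.symm, ?_, fun c ↦ hslab c₀ c hc₀⟩
  · rw [hU'eq]; exact hsub
  · intro x hx _
    by_cases hTT : 0 ≤ 𝓑.metric.val x (𝓑.killing x) (𝓑.killing x)
    · exact hergo x hx hTT
    · exact 𝓑.metric.exists_pos_val_and_mfderiv_eq_val (T := 𝓑.killing) (not_le.mp hTT)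
        (hρT x hx) (hρreg x hx)

/-- S1b read back: the registered (inlined) statement is `∃ ρ, IsInvariantRadialFunction 𝓑 ρ` under h1–h5, h8
(definitional unfolding). [folklore] -/
theorem stub_invariantRadialFunction_iff :
    stub_invariantRadialFunction ↔
      ∀ (𝓑 : StationaryAFBlackHole.{0}) [𝓑.metric.HasLeviCivita],
        𝓑.metric.toPseudoRiemannianMetric.IsRicciFlat → 𝓑.IsIPlusRegular →
        (∀ p : 𝓑.carrier, p ∈ 𝓑.metric.chronologicalFuture 𝓑.timeOrientation 𝓑.Mext) →
        (∀ p ∈ 𝓑.doc, 𝓑.killing p ≠ 0) → SimplyConnectedSpace 𝓑.doc → IsConnected 𝓑.horizon →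
        ∃ ρ : 𝓑.carrier → ℝ, IsInvariantRadialFunction 𝓑 ρ :=
  Iff.rfl

/-- S4b read back in the vocabulary of §1 (definitional unfolding up to binder order). [folklore] -/
theorem stub_adaptedAnalyticSweep_iff :
    stub_adaptedAnalyticSweep ↔
      ∀ (𝓑 : StationaryAFBlackHole.{0}) [𝓑.metric.HasLeviCivita]
        (U : Set 𝓑.carrier) (K : Π x : 𝓑.carrier, TangentSpace (𝓡 4) x),
        𝓑.metric.toPseudoRiemannianMetric.IsRicciFlat → 𝓑.IsIPlusRegular →
        (∀ p : 𝓑.carrier, p ∈ 𝓑.metric.chronologicalFuture 𝓑.timeOrientation 𝓑.Mext) →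
        (∀ p ∈ 𝓑.doc, 𝓑.killing p ≠ 0) → SimplyConnectedSpace 𝓑.doc →
        IsKillingTimelikeCollar 𝓑 U K → BeltCompactModFlow 𝓑 U → NoTrappedGeodesicModFlow 𝓑 →
          ∀ ρ₀ : 𝓑.carrier → ℝ, IsInvariantRadialFunction 𝓑 ρ₀ →
            ∃ ρ : 𝓑.carrier → ℝ, IsInvariantRadialFunction 𝓑 ρ ∧
              ∀ q ∈ 𝓑.doc, 0 ≤ 𝓑.metric.val q (𝓑.killing q) (𝓑.killing q) →
                TwoVariableAnalyticAdaptedAt 𝓑 ρ q := by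
  constructor
  · intro h 𝓑 _ U K h1 h2 h3 h4 h5 ⟨hU, hHU, hconn, ⟨hsm, hkil, hcomm⟩, hne, htan, htl⟩ hbelt hnt
    exact h 𝓑 h1 h2 h3 h4 h5 U K hU hHU hconn hsm hkil hcomm hne htan htl hbelt hnt
  · intro h 𝓑 _ h1 h2 h3 h4 h5 U K hU hHU hconn hsm hkil hcomm hne htan htl hbelt hnt
    exact h 𝓑 U K h1 h2 h3 h4 h5 ⟨hU, hHU, hconn, ⟨hsm, hkil, hcomm⟩, hne, htan, htl⟩ hbelt hnt

/-- **S1a + S1b + S4b give the sub-collar-and-sweep datum AND the adapted engine** of the composition: the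
`T`-invariant Killing sub-collar `(U₁, K₁)` (S1a, landed; fed by the time function S1c), a structural radial
function `ρ₀` (S1b), the engine's adapted radial function `ρ` (S4b) with its spacelike gradient on the closed
ergoregion (`TwoVariableAnalyticAdaptedAt.spacelike_gradient` + (R3)), and W5's reduction `sweep_of_radial` give
`(U', f := ρ, c₀, K₀ := K₁)` with `IsTimelikeSweep 𝓑 U' f c₀`, `IsLocalKilling 𝓑 (U' ∩ 𝓑.doc) K₀`, docking on
`U''`, and two-variable analyticity at every point of the closed ergoregion. [folklore] -/
theorem collarSweep_of (h₁ : stub_invariantKillingSubcollar) (h₁' : stub_docTimeFunction)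
    (h₂ : stub_invariantRadialFunction) (h₄ : stub_adaptedAnalyticSweep) :
    ∀ (𝓑 : StationaryAFBlackHole.{0}) [𝓑.metric.HasLeviCivita]
      (U : Set 𝓑.carrier) (K : Π x : 𝓑.carrier, TangentSpace (𝓡 4) x),
      𝓑.metric.toPseudoRiemannianMetric.IsRicciFlat → 𝓑.IsIPlusRegular →
      (∀ p : 𝓑.carrier, p ∈ 𝓑.metric.chronologicalFuture 𝓑.timeOrientation 𝓑.Mext) →
      (∀ p ∈ 𝓑.doc, 𝓑.killing p ≠ 0) → SimplyConnectedSpace 𝓑.doc →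
      IsKillingTimelikeCollar 𝓑 U K → BeltCompactModFlow 𝓑 U → NoTrappedGeodesicModFlow 𝓑 →
        ∃ (U' : Set 𝓑.carrier) (f : 𝓑.carrier → ℝ) (c₀ : ℝ)
          (K₀ : Π x : 𝓑.carrier, TangentSpace (𝓡 4) x),
          IsOpen U' ∧ 𝓑.horizon ⊆ U' ∧ IsTimelikeSweep 𝓑 U' f c₀ ∧ IsLocalKilling 𝓑 (U' ∩ 𝓑.doc) K₀ ∧
          (∃ U'' : Set 𝓑.carrier, IsOpen U'' ∧ 𝓑.horizon ⊆ U'' ∧ ∀ x ∈ U'' ∩ 𝓑.doc, K₀ x = K x) ∧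
          ∀ q ∈ 𝓑.doc, 0 ≤ 𝓑.metric.val q (𝓑.killing q) (𝓑.killing q) → TwoVariableAnalyticAt 𝓑 q := by
  intro 𝓑 _ U K hvac hreg hfp hT hsc ⟨hU, hHU, hconn, ⟨hsm, hkil, hcomm⟩, hne, htan, htl⟩ hbelt hnt
  obtain ⟨U₁, V, U'', K₁, hU₁, hHU₁, hinv, hV, hHV, hVU, hVU₁, ⟨hsm₁, hkil₁, hcomm₁⟩, hU'', hHU'',
    hdock⟩ :=
    (h₁ : type_of% Holds.stub_invariantKillingSubcollar) (h₁' : type_of% Holds.stub_docTimeFunction) 𝓑 hvac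
      hreg hfp hT hsc U K hU hHU hconn hsm hkil hcomm hne htan htl hbelt hnt
  obtain ⟨ρ₀, hρ₀⟩ : ∃ ρ₀ : 𝓑.carrier → ℝ, IsInvariantRadialFunction 𝓑 ρ₀ :=
    (h₂ : type_of% Holds.stub_invariantRadialFunction) 𝓑 hvac hreg hfp hT hsc hconn
  obtain ⟨ρ, hρ, hadapt⟩ : ∃ ρ : 𝓑.carrier → ℝ, IsInvariantRadialFunction 𝓑 ρ ∧
      ∀ q ∈ 𝓑.doc, 0 ≤ 𝓑.metric.val q (𝓑.killing q) (𝓑.killing q) → TwoVariableAnalyticAdaptedAt 𝓑 ρ q :=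
    (h₄ : type_of% Holds.stub_adaptedAnalyticSweep) 𝓑 hvac hreg hfp hT hsc U K hU hHU hconn hsm hkil hcomm
      hne htan htl hbelt hnt ρ₀ hρ₀
  have hergo : ∀ x ∈ 𝓑.doc, 0 ≤ 𝓑.metric.val x (𝓑.killing x) (𝓑.killing x) →
      ∃ w : TangentSpace (𝓡 4) x, 0 < 𝓑.metric.val x w w ∧
        ∀ u : TangentSpace (𝓡 4) x, mfderiv (𝓡 4) 𝓘(ℝ, ℝ) ρ x u = 𝓑.metric.val x w u :=
    fun x hx hTT ↦ (hadapt x hx hTT).spacelike_gradient (hρ.2.2.1 x hx)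
  obtain ⟨U', c₀, hU', hHU', hU'U₁, hsweep⟩ := sweep_of_radial 𝓑 hρ hergo U₁ hU₁ hHU₁ hinv
  have hsub : U' ∩ 𝓑.doc ⊆ U₁ ∩ 𝓑.doc := fun x hx ↦ ⟨hU'U₁ hx, hx.2⟩
  exact ⟨U', ρ, c₀, K₁, hU', hHU', hsweep,
    ⟨hsm₁.mono hsub, fun x hx ↦ hkil₁ x (hsub hx), fun x hx ↦ hcomm₁ x (hsub hx)⟩,
    ⟨U'', hU'', hHU'', hdock⟩, fun q hq hTT ↦ (hadapt q hq hTT).twoVariableAnalyticAt⟩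

/-- S2 read back in the vocabulary of §1 (definitional unfolding). [folklore] -/
theorem stub_pointContinuation_iff :
    stub_pointContinuation ↔
      ∀ (𝓑 : StationaryAFBlackHole.{0}) [𝓑.metric.HasLeviCivita],
        𝓑.metric.toPseudoRiemannianMetric.IsRicciFlat →
        ∀ (D : Set 𝓑.carrier) (L : Π x : 𝓑.carrier, TangentSpace (𝓡 4) x),
          IsOpen D → D ⊆ 𝓑.doc → IsLocalKilling 𝓑 D L →
          ∀ q ∈ 𝓑.doc, ∀ f : 𝓑.carrier → ℝ, NonNullSupportAt 𝓑 D q f → TwoVariableAnalyticAt 𝓑 q →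
            PointContinuationAt 𝓑 D L q :=
  Iff.rfl

/-- S3 read back in the vocabulary of §1 (definitional unfolding). [folklore] -/
theorem stub_slabPatching_iff :
    stub_slabPatching ↔
      ∀ (𝓑 : StationaryAFBlackHole.{0}) [𝓑.metric.HasLeviCivita], 𝓑.IsIPlusRegular →
        ∀ (U' : Set 𝓑.carrier) (f : 𝓑.carrier → ℝ) (c₀ : ℝ), IsTimelikeSweep 𝓑 U' f c₀ →
        ∀ c : ℝ, c₀ ≤ c →
        ∀ L : Π x : 𝓑.carrier, TangentSpace (𝓡 4) x, IsLocalKilling 𝓑 (subLevel 𝓑 f c) L →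
          (∀ q ∈ 𝓑.doc, f q = c → PointContinuationAt 𝓑 (subLevel 𝓑 f c) L q) →
          ∃ ε : ℝ, 0 < ε ∧ ∃ L' : Π x : 𝓑.carrier, TangentSpace (𝓡 4) x,
            IsLocalKilling 𝓑 (subLevel 𝓑 f (c + ε)) L' ∧ ∀ x ∈ subLevel 𝓑 f c, L' x = L x :=
  Iff.rfl

/-- S4a read back in the vocabulary of §1 (definitional unfolding). [folklore] -/
theorem stub_twoVariableAnalyticitySeeds_iff :
    stub_twoVariableAnalyticitySeeds ↔
      (mullerZumHagen1970_analytic_of_timelikeKilling →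
      ∀ (𝓑 : StationaryAFBlackHole.{0}) [𝓑.metric.HasLeviCivita]
        (U : Set 𝓑.carrier) (K : Π x : 𝓑.carrier, TangentSpace (𝓡 4) x),
        𝓑.metric.toPseudoRiemannianMetric.IsRicciFlat → 𝓑.IsIPlusRegular →
        (∀ p : 𝓑.carrier, p ∈ 𝓑.metric.chronologicalFuture 𝓑.timeOrientation 𝓑.Mext) →
        (∀ p ∈ 𝓑.doc, 𝓑.killing p ≠ 0) → SimplyConnectedSpace 𝓑.doc →
        IsKillingTimelikeCollar 𝓑 U K → BeltCompactModFlow 𝓑 U → NoTrappedGeodesicModFlow 𝓑 →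
          ∀ q ∈ 𝓑.doc, (𝓑.metric.val q (𝓑.killing q) (𝓑.killing q) < 0 ∨ q ∈ U) →
            TwoVariableAnalyticAt 𝓑 q) := by
  constructor
  · intro h hM 𝓑 _ U K h1 h2 h3 h4 h5 ⟨hU, hHU, hconn, ⟨hsm, hkil, hcomm⟩, hne, htan, htl⟩ hbelt hnt
    exact h hM 𝓑 h1 h2 h3 h4 h5 U K hU hHU hconn hsm hkil hcomm hne htan htl hbelt hnt
  · intro h hM 𝓑 _ h1 h2 h3 h4 h5 U K hU hHU hconn hsm hkil hcomm hne htan htl hbelt hnt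
    exact h hM 𝓑 U K h1 h2 h3 h4 h5 ⟨hU, hHU, hconn, ⟨hsm, hkil, hcomm⟩, hne, htan, htl⟩ hbelt hnt

end ReadBack

/-! ## §4 The composition (sorry-free): Zorn on anchored partial continuations -/

section Composition

variable {𝓑 : StationaryAFBlackHole.{0}} [𝓑.metric.HasLeviCivita]
  {U' : Set 𝓑.carrier} {f : 𝓑.carrier → ℝ} {c₀ : ℝ}
  {K₀ : Π x : 𝓑.carrier, TangentSpace (𝓡 4) x}

variable (𝓑 U' f c₀ K₀) in
/-- An ANCHORED PARTIAL CONTINUATION of the sub-collar field `K₀` along the sweep `f`: a level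
`c ∈ [c₀, +∞]` (in `EReal`) and a local `T`-commuting Killing field `L` on `{f < c} ∩ doc` which equals
`K₀` on the sub-collar `U' ∩ doc`.  Level `⊤` means: `L` lives on the whole d.o.c. [folklore] -/
structure Cont where
  /-- the level reached -/
  c : EReal
  /-- the continued field (a global section; only its values on `{f < c} ∩ doc` matter) -/
  L : Π x : 𝓑.carrier, TangentSpace (𝓡 4) x
  /-- the level is at least the bottom level of the sweep -/
  hc : ((c₀ : ℝ) : EReal) ≤ c
  /-- `L` is a local `T`-commuting Killing field below the level -/
  killing : IsLocalKilling 𝓑 {x | x ∈ 𝓑.doc ∧ ((f x : ℝ) : EReal) < c} L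
  /-- `L` is anchored to the sub-collar field -/
  anchored : ∀ x ∈ U' ∩ 𝓑.doc, L x = K₀ x

/-- Partial continuations are ordered by EXTENSION: `a ≤ b` iff `b` reaches at least the level of `a`
and agrees with `a` below the level of `a`.  (A preorder; antisymmetry fails off the domains.) [folklore] -/
instance : Preorder (Cont 𝓑 U' f c₀ K₀) where
  le a b := a.c ≤ b.c ∧ ∀ x ∈ 𝓑.doc, ((f x : ℝ) : EReal) < a.c → b.L x = a.L x
  le_refl a := ⟨le_rfl, fun _ _ _ ↦ rfl⟩
  le_trans a b d hab hbd :=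
    ⟨hab.1.trans hbd.1, fun x hx hlt ↦ (hbd.2 x hx (lt_of_lt_of_le hlt hab.1)).trans (hab.2 x hx hlt)⟩

omit [𝓑.metric.HasLeviCivita] in
/-- Unfolding lemma for the extension order. [folklore] -/
theorem Cont.le_def [𝓑.metric.HasLeviCivita] {a b : Cont 𝓑 U' f c₀ K₀} :
    a ≤ b ↔ a.c ≤ b.c ∧ ∀ x ∈ 𝓑.doc, ((f x : ℝ) : EReal) < a.c → b.L x = a.L x := Iff.rfl

/-- For a real level the `EReal` domain of a partial continuation is the sub-level set. [folklore] -/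
theorem setOf_ereal_lt_coe (c : ℝ) :
    {x | x ∈ 𝓑.doc ∧ ((f x : ℝ) : EReal) < (c : EReal)} = subLevel 𝓑 f c := by
  ext x
  simp only [mem_setOf_eq, EReal.coe_lt_coe_iff, mem_subLevel]

/-- At level `⊤` the domain of a partial continuation is the whole d.o.c. [folklore] -/
theorem setOf_ereal_lt_top :
    {x | x ∈ 𝓑.doc ∧ ((f x : ℝ) : EReal) < (⊤ : EReal)} = 𝓑.doc := by
  ext x
  simp only [mem_setOf_eq, EReal.coe_lt_top, and_true]

/-- The `EReal`-domain `{x ∈ doc | f x < c}` of a level is open when `f` is continuous on the d.o.c. [folklore] -/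
theorem isOpen_setOf_ereal_lt (hf : ContinuousOn f 𝓑.doc) (c : EReal) :
    IsOpen {x | x ∈ 𝓑.doc ∧ ((f x : ℝ) : EReal) < c} := by
  have : {x | x ∈ 𝓑.doc ∧ ((f x : ℝ) : EReal) < c} = 𝓑.doc ∩ f ⁻¹' {r : ℝ | (r : EReal) < c} := by
    ext x; simp only [mem_setOf_eq, mem_inter_iff, mem_preimage]
  rw [this]
  exact hf.isOpen_inter_preimage (isOpen_doc 𝓑) (isOpen_Iio.preimage continuous_coe_real_ereal)

/-- **Chains of partial continuations have upper bounds** (the gluing step of Zorn).  The base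
continuation `(c₀, K₀)` bounds the empty chain; a non-empty chain is bounded by the supremum level with
the GLUED field (well defined because any two members of a chain are comparable, and comparable members
agree below the smaller level), which is a local `T`-commuting Killing field by `IsLocalKilling.of_locally`.
[folklore] -/
theorem Cont.bddAbove_of_isChain (hf : ContinuousOn f 𝓑.doc) (hbase : subLevel 𝓑 f c₀ = U' ∩ 𝓑.doc)
    (hK₀ : IsLocalKilling 𝓑 (U' ∩ 𝓑.doc) K₀)
    (S : Set (Cont 𝓑 U' f c₀ K₀)) (hS : IsChain (· ≤ ·) S) : BddAbove S := by
  classical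
  rcases S.eq_empty_or_nonempty with rfl | hne
  · -- the base continuation bounds the empty chain
    refine ⟨⟨(c₀ : EReal), K₀, le_rfl, ?_, fun _ _ ↦ rfl⟩, fun _ h ↦ h.elim⟩
    rw [setOf_ereal_lt_coe, hbase]
    exact hK₀
  · -- glue the chain
    let cs : EReal := sSup (Cont.c '' S)
    let Lg : Π x : 𝓑.carrier, TangentSpace (𝓡 4) x := fun x ↦
      if h : ∃ a ∈ S, ((f x : ℝ) : EReal) < a.c then h.choose.L x else K₀ x
    -- comparable members agree below the smaller level
    have hagree : ∀ a ∈ S, ∀ b ∈ S, ∀ x ∈ 𝓑.doc,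
        ((f x : ℝ) : EReal) < a.c → ((f x : ℝ) : EReal) < b.c → a.L x = b.L x := by
      intro a ha b hb x hx hxa hxb
      rcases hS.total ha hb with hab | hba
      · exact (hab.2 x hx hxa).symm
      · exact hba.2 x hx hxb
    -- the glued field agrees with every member below that member's level
    have hLg : ∀ a ∈ S, ∀ x ∈ 𝓑.doc, ((f x : ℝ) : EReal) < a.c → Lg x = a.L x := by
      intro a ha x hx hxa
      have h : ∃ a ∈ S, ((f x : ℝ) : EReal) < a.c := ⟨a, ha, hxa⟩
      simp only [Lg, dif_pos h]
      exact hagree _ h.choose_spec.1 a ha x hx h.choose_spec.2 hxa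
    obtain ⟨a₀, ha₀⟩ := hne
    refine ⟨⟨cs, Lg, ?_, ?_, ?_⟩, ?_⟩
    · -- level ≥ c₀
      exact a₀.hc.trans (le_sSup (mem_image_of_mem Cont.c ha₀))
    · -- local Killing on the glued domain
      refine IsLocalKilling.of_locally fun x hx ↦ ?_
      obtain ⟨hxdoc, hxlt⟩ := hx
      obtain ⟨_, ⟨a, ha, rfl⟩, hxa⟩ := lt_sSup_iff.mp hxlt
      refine ⟨{y | y ∈ 𝓑.doc ∧ ((f y : ℝ) : EReal) < a.c}, a.L, isOpen_setOf_ereal_lt hf a.c,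
        ⟨hxdoc, hxa⟩, a.killing, fun y hy ↦ hLg a ha y hy.1 hy.2⟩
    · -- anchored
      intro x hx
      have hx' : x ∈ subLevel 𝓑 f c₀ := hbase ▸ hx
      have hlt : ((f x : ℝ) : EReal) < a₀.c :=
        lt_of_lt_of_le (EReal.coe_lt_coe_iff.mpr hx'.2) a₀.hc
      rw [hLg a₀ ha₀ x hx.2 hlt]
      exact a₀.anchored x hx
    · -- upper bound
      intro a ha
      exact ⟨le_sSup (mem_image_of_mem Cont.c ha), fun x hx hxa ↦ hLg a ha x hx hxa⟩

end Composition

/-- **`NonTrappingHawkingRigidity_of` — THE SKELETON.**  S1 (sub-collar + timelike sweep), S2 (point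
continuation under two-variable analyticity: Tataru–Robbiano–Zuily–Hörmander on the IK system), S3 (slab
patching) and S4 (the engine C⁺) give the crux `AnalyticityInvadesErgoregion.NonTrappingHawkingRigidity` (= `ZeroEnergyKerrOrBomb.NonTrappingHawkingRigidity`, `NonTrappingHawkingRigidity_of'`) BY NAME.
Proof: Zorn's lemma on anchored partial continuations of the sub-collar field along the sweep (chains
glue: `Cont.bddAbove_of_isChain`); a maximal element of finite level `c` would be strictly extended —
every point of the level `{f = c}` is supported through a non-null (spacelike-gradient) level of `f` by the
sub-level set, is two-variable analytic by S4, hence admits a one-step continuation by S2, and S3 patches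
these to `{f < c + ε}` —; so the maximal level is `⊤`, its field is Killing and `T`-commuting on the whole
d.o.c., and it docks to `K` on `U' ∩ U''` by anchoring. [folklore] -/
theorem NonTrappingHawkingRigidity_of (h1c : stub_docTimeFunction)
    (h1b : stub_invariantRadialFunction) (h2 : stub_pointContinuation)
    (h4b : stub_adaptedAnalyticSweep) (h4c : stub_mullerZumHagen) : NonTrappingHawkingRigidity := by
  intro 𝓑 _ hvac hreg hfp h5 hsc U K hU hHU hconn hsm hkil hcomm hne htan htl hbelt hnt
  obtain ⟨U', f, c₀, K₀, hU'o, hHU', ⟨hfs, hfT, hbase, hgrad, hproper⟩, hK₀', ⟨U'', hU''o, hHU'', hdock⟩,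
      hCergo⟩ :=
    collarSweep_of Holds.stub_invariantKillingSubcollar h1c h1b h4b 𝓑 U K hvac hreg hfp h5 hsc
      ⟨hU, hHU, hconn, ⟨hsm, hkil, hcomm⟩, hne, htan, htl⟩ hbelt hnt
  -- the engine at every point of the d.o.c.: seeds (S4a, LANDED, fed by the Müller zum Hagen debt S4c) where
  -- `T` is timelike or on the collar, the adapted engine (S4b) on the closed ergoregion
  have hC : ∀ q ∈ 𝓑.doc, TwoVariableAnalyticAt 𝓑 q := by
    intro q hq
    by_cases hreg' : 𝓑.metric.val q (𝓑.killing q) (𝓑.killing q) < 0 ∨ q ∈ U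
    · exact Holds.stub_twoVariableAnalyticitySeeds (h4c : type_of% Holds.stub_mullerZumHagen)
        𝓑 hvac hreg hfp h5 hsc U K hU hHU hconn hsm hkil hcomm hne htan htl hbelt hnt q hq hreg'
    · simp only [not_or, not_lt] at hreg'
      exact hCergo q hq hreg'.1
  have hfc : ContinuousOn f 𝓑.doc := hfs.continuousOn
  -- the step: a partial continuation of finite level is strictly extended
  have step : ∀ a : Cont 𝓑 U' f c₀ K₀, a.c ≠ ⊤ → ∃ b : Cont 𝓑 U' f c₀ K₀, a ≤ b ∧ a.c < b.c := by
    intro a hatop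
    have habot : a.c ≠ ⊥ := ne_bot_of_le_ne_bot (EReal.coe_ne_bot c₀) a.hc
    set c : ℝ := a.c.toReal with hcdef
    have hac : a.c = (c : EReal) := (EReal.coe_toReal hatop habot).symm
    have hc₀c : c₀ ≤ c := by
      have := a.hc; rw [hac] at this; exact EReal.coe_le_coe_iff.mp this
    have hdom : {x | x ∈ 𝓑.doc ∧ ((f x : ℝ) : EReal) < a.c} = subLevel 𝓑 f c := by
      rw [hac]; exact setOf_ereal_lt_coe c
    have hL : IsLocalKilling 𝓑 (subLevel 𝓑 f c) a.L := hdom ▸ a.killing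
    -- pointwise continuations along the level `{f = c}`
    have hpt : ∀ q ∈ 𝓑.doc, f q = c → PointContinuationAt 𝓑 (subLevel 𝓑 f c) a.L q := by
      intro q hq hfq
      have hsupp : NonNullSupportAt 𝓑 (subLevel 𝓑 f c) q f := by
        obtain ⟨w, hw, hdw⟩ := hgrad q hq (hfq ▸ hc₀c)
        refine ⟨𝓑.doc, isOpen_doc 𝓑, hq, hfs, ⟨w, ne_of_gt hw, hdw⟩, ?_⟩
        intro x hx
        rw [hfq]
        exact ⟨fun h ↦ h.2, fun hlt ↦ ⟨hx.2, hlt⟩⟩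
      exact (h2 : type_of% Holds.stub_pointContinuation) 𝓑 hvac (subLevel 𝓑 f c) a.L
        (isOpen_subLevel hfc c) (subLevel_subset_doc f c) hL q hq f hsupp (hC q hq)
    obtain ⟨ε, hε, L', hL', hext⟩ :=
      Holds.stub_slabPatching 𝓑 hreg U' f c₀ ⟨hfs, hfT, hbase, hgrad, hproper⟩ c hc₀c
        a.L hL hpt
    have hL'' : IsLocalKilling 𝓑 (subLevel 𝓑 f (c + ε)) L' := hL'
    refine ⟨⟨((c + ε : ℝ) : EReal), L', ?_, ?_, ?_⟩, ?_, ?_⟩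
    · exact EReal.coe_le_coe_iff.mpr (hc₀c.trans (le_add_of_nonneg_right hε.le))
    · rw [setOf_ereal_lt_coe]; exact hL''
    · intro x hx
      have hx' : x ∈ subLevel 𝓑 f c := subLevel_mono f hc₀c (hbase ▸ hx : x ∈ subLevel 𝓑 f c₀)
      rw [hext x hx']
      exact a.anchored x hx
    · refine ⟨?_, fun x hx hlt ↦ ?_⟩
      · show a.c ≤ ((c + ε : ℝ) : EReal)
        rw [hac]; exact EReal.coe_le_coe_iff.mpr (le_add_of_nonneg_right hε.le)
      · rw [hac] at hlt
        exact hext x ⟨hx, EReal.coe_lt_coe_iff.mp hlt⟩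
    · show a.c < ((c + ε : ℝ) : EReal)
      rw [hac]; exact EReal.coe_lt_coe_iff.mpr (lt_add_of_pos_right c hε)
  -- Zorn
  obtain ⟨m, hm⟩ : ∃ m : Cont 𝓑 U' f c₀ K₀, IsMax m :=
    zorn_le (fun S hS ↦ Cont.bddAbove_of_isChain hfc hbase hK₀' S hS)
  have hmtop : m.c = ⊤ := by
    by_contra hne'
    obtain ⟨b, hmb, hlt⟩ := step m hne'
    exact (lt_irrefl m.c) (lt_of_lt_of_le hlt (hm hmb).1)
  have hKill : IsLocalKilling 𝓑 𝓑.doc m.L := by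
    have := m.killing
    rw [hmtop, setOf_ereal_lt_top] at this
    exact this
  refine ⟨m.L, hKill.1, hKill.2.1, hKill.2.2, U' ∩ U'', hU'o.inter hU''o, subset_inter hHU' hHU'', ?_⟩
  rintro x ⟨⟨hxU', hxU''⟩, hxdoc⟩
  rw [m.anchored x ⟨hxU', hxdoc⟩]
  exact hdock x ⟨hxU'', hxdoc⟩

/-- D-0027 §3.3: the crux from the registered stubs themselves (a proof of the crux once the four
`sorry`s are discharged; until then it is `sorry`-tainted through the stubs and credits nothing). -/
theorem NonTrappingHawkingRigidity_proof : NonTrappingHawkingRigidity :=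
  NonTrappingHawkingRigidity_of Holds.stub_docTimeFunction Holds.stub_invariantRadialFunction
    Holds.stub_pointContinuation Holds.stub_adaptedAnalyticSweep Holds.stub_mullerZumHagen

/-- The two routes wanting the crux type it with letter-identical bodies: the skeleton closes the
`ZeroEnergyKerrOrBomb` copy (stmt-13896 as wanted by route `ZeroEnergyKerrOrBomb`, rank 2)
definitionally as well. [folklore] -/
theorem NonTrappingHawkingRigidity_of' (h1c : stub_docTimeFunction)
    (h1b : stub_invariantRadialFunction) (h2 : stub_pointContinuation)
    (h4b : stub_adaptedAnalyticSweep) (h4c : stub_mullerZumHagen) :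
    Summit.FinalStateConjecture.FinalStateConjecture.Theses.ZeroEnergyKerrOrBomb.NonTrappingHawkingRigidity :=
  NonTrappingHawkingRigidity_of h1c h1b h2 h4b h4c

end Summit.FinalStateConjecture.FinalStateConjecture.Cruxes.NonTrappingHawkingRigidity.AzimuthalPartialAnalyticity

end
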